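import Literature.Computability.AlgebraicComplexity.PowerSumWaringRankEquation
import Literature.Computability.AlgebraicComplexity.HwvEvaluationRankBound
import Literature.Computability.AlgebraicComplexity.DeterminantIrreducible
import Literature.NumberTheory.DiophantineGeometry.SchurWeylPlethysmKroneckerBoundProofs
import Mathlib.RingTheory.MvPolynomial.WeightedHomogeneous
import HarnessLib

/-!
# Ikenmeyer–Kandasamy's Thm. 4.3: `ν = (4m, 2m, …, 2m)` is a multiplicity obstruction
# separating the power sum from the product of variables

Topic `Literature/Computability/AlgebraicComplexity` (geometric complexity theory: the toy pair
power sum `p = x₁^m + ⋯ + x_m^m` versus the monomial `q = x₁ ⋯ x_m` of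
`PowerSumProductObstructions.lean`). This file DISCHARGES the named fact `IK2020_thm_4_3`:

* C. Ikenmeyer, U. Kandasamy, *Implementing geometric complexity theory: On the separation of
  orbit closures via symmetries*, STOC 2020 = arXiv:1911.03990, Thm. 4.3 (e-print p. 8), AS
  PRINTED: "Let `m = D ≥ 4` be even. Let `d = 2`. Let `λ = (2m)` and let `ν = (2m) + (m × 2m)`.
  Let `p := x_1^m + ⋯ + x_m^m` and `q := x_1 x_2 ⋯ x_m`. … • … `mult_{ν^*} ℂ[\overline{Gp}] ≥ 2`.
  • `1 ≥ mult_{ν^*} ℂ[Gq] ≥ mult_{ν^*} ℂ[\overline{Gq}]`. In particular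
  `mult_{ν^*} ℂ[\overline{Gp}] ≥ 2 > 1 ≥ mult_{ν^*} ℂ[\overline{Gq}]` and hence `ν` is a
  multiplicity obstruction that proves the separation `\overline{Gp} ⊄ \overline{Gq}`."

as `theorem IK2020_thm_4_3_holds : IK2020_thm_4_3` (the tree's `IK2020_thm_4_3` records exactly
the two bullets: `2 ≤ mult_{ν^*}` for `p` and `mult_{ν^*} ≤ 1` for `q`, every even `m ≥ 4`).
Honest framing of the cell served (`pub-gct-max`, track T): a kernel discharge of one cited,
printed theorem about the toy model; nothing here is a claim on VP vs VNP or P vs NP.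

## Proof route — elementary certificates, NOT the printed route

IK derive the first bullet from their Main Technical Theorem 4.2 (tableau lifting, §6–§10 of the
paper) with `b((2m),(2),m,2) = b((2m),(1,1),m,2) = 1`, and the second from
`mult_{ν^*} ℂ[Gq] = a_ν(m, 2m+2) ≤ K(ν, m × (2m+2)) = 1` ([Lan:17], [Gay:76]: "It is clear from the
special shape of `ν` that this Kostka number is 1"). Here instead:

* **First bullet (§1–§4)** — two explicit highest-weight vectors and two closure points
  (Bürgisser–Ikenmeyer 2013 §4 / Dörfler–Ikenmeyer–Panova 2020 §5; tree
  `le_orbitMultiplicity_of_det_eval_ne_zero_of_mem_orbitClosure`, `HwvEvaluationRankBound`):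
  the tableau polynomials `F_A`, `F_C` (`IK2020.polyA`, `IK2020.polyC`) of two tableaux
  `T_A`, `T_C` of shape `ν` filled with `2m+2` labels, each `m` times (`IK2020.tabA/tabC`,
  written out in §1: an `m × m` block `A` whose columns read `(0, …, m-1)ᵀ`, an `m × m` block
  `B`, and `2m` singleton columns), are highest-weight vectors of weight `ν^*` (IK Thm. 11.1 =
  tree `TabM.tabPoly_mem_highestWeightSpace`) and are evaluated by Thm. 11.1's formula
  (`TabM.EC_powers` of `PowerSumWaringRankEquation.lean`) at the two points `p = 1 · p` and
  `A′ · p`, `A′ = 1 + E_{top,bot}` (`IK2020.matT`), of `\overline{Gp}`: every summand is `0` or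
  `1` (`termA_one`, `termC_one`, `termC_matT`), `F_A(p) ≠ 0`, `F_C(p) = 0`, `F_C(A′ p) ≠ 0`
  (`aeval_polyA_one_ne_zero`, `aeval_polyC_one_eq_zero`, `aeval_polyC_matT_ne_zero`), so the
  `2 × 2` evaluation matrix is triangular with nonzero diagonal and
  `2 ≤ mult_{ν^*} ℂ[\overline{Gp}]` (`IK2020.two_le_orbitMultiplicity_psum`).
* **Second bullet (§5–§10)** — as in print through `ℂ[\overline{Gq}] ⊆ ℂ[Gq] ⊆ ℂ[GL_m]`:
  the tree's injection `HW_χ(ℂ[\overline{Gq}]) ↪ ℂ[Mat_m]` (`hwToPoly`, BLMW 2011 §5.2,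
  `SchurWeylPlethysmKroneckerBoundProofs` §1) lands in polynomials `P` with
  `P(bg) = χ(b)⁻¹ P(g)` (`b` upper triangular) and `P(gh) = P(g)` for the elements
  `h = diag(…, 2, …, 2⁻¹, …)` of the stabilizer of `q` (`IK2020.IsIKPoly`). Such `P` form a space
  of dimension `≤ 1` (`IK2020.mem_span_P0` — the counterpart of "`K(ν, m × (2m+2)) = 1`"): the
  torus identities make `P` bihomogeneous of row degrees `(2m, …, 2m, 4m)` and column degrees
  `((2m+2)^m)` (`rowDeg_eq`, `colDeg_eq`; `GL` Zariski dense, Mathlib `eq_of_eval_eq_on_gl`);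
  replacing the row `0` of `g` by `det(g) e_0` is left multiplication by an upper triangular
  matrix with diagonal `(d(g), 1, …, 1)`, `d` = the minor of `z_{00}`, whence
  `d^{2m} P = det^{2m} P([e_0; z_1; …])` (`det_pow_dvd`); `det` is prime and `det ∤ d`
  (tree `prime_det_of_X`, `DeterminantIrreducible`), so `P = det^{2m} P₁` with `P₁` bihomogeneous
  of bidegree `((0, …, 0, 2m), (2^m))` (`isWeightedHomogeneous_of_mul`), i.e.
  `P₁ = c ∏_j z_{m-1,j}^2` (`eq_e0`). Hence `mult_{ν^*} ℂ[\overline{Gq}] ≤ 1`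
  (`IK2020.orbitMultiplicity_chowMonomial_le_one`, `IK2020.orbitMultiplicity_chow_le_one`).

Internally `m = 2k + 4`; `IK2020_thm_4_3_holds` substitutes `m = 2(r−2) + 4` for even
`m = r + r ≥ 4`. A few private conveniences of `PowerSumWaringRankEquation.lean` (values of
`ν^*` on the antitone enumeration, the column count of `hgt`, the coordinate presentation of
`p`) are re-derived privately (suffix `₂`).

## References

* C. Ikenmeyer, U. Kandasamy, Proc. 52nd ACM STOC (2020) 713–726 = arXiv:1911.03990: §3, Thm. 4.3,
  Thm. 11.1. [IkenmeyerKandasamy2019]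
* J. Dörfler, C. Ikenmeyer, G. Panova, SIAM J. Appl. Algebra Geom. 4 (2020), §5 (highest-weight
  vectors from tableaux; evaluation at points of the orbit closure). [DorflerIkenmeyerPanova2020]
* P. Bürgisser, J. M. Landsberg, L. Manivel, J. Weyman, SIAM J. Comput. 40 (2011), §5.2
  (`ℂ[\overline{GL·x}] ⊆ ℂ[GL·x] = ℂ[GL]^{Stab}`; semi-invariants as polynomials on `Mat`). [BLMW2011]

## Mathlib and tree

Tree: `TabM`, `tabPoly`, `tabPoly_mem_highestWeightSpace`, `aeval_formCoeff_tabPoly`, `splfPoly`,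
`linSubst_splfPoly`, `TabM.Frame`, `IsAntitoneEnum` (`TableauPolynomial`, `TableauHighestWeight`,
`TableauScaling`), `TabM.EC_powers`, `IK2020.hgt`, `IK2020.xEnum` (`PowerSumWaringRankEquation`),
`le_orbitMultiplicity_of_det_eval_ne_zero_of_mem_orbitClosure`, `linSubst_mem_orbitClosure`
(`HwvEvaluationRankBound`), `hwToPoly`, `orbitCoordToPoly`, `eval_orbitCoordToPoly_mul_left/right`
(`SchurWeylPlethysmKroneckerBoundProofs`), `torusElt`, `weightChar_torusElt` (`OrbitClosureWeights`),
`prime_det_of_X` (`DeterminantIrreducible`), `chowMonomial` (`NotViaSaturationsChow`), `ikPartition`,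
`IK2020_thm_4_3` (`PowerSumProductObstructions`). Mathlib: `Matrix.transvection`, `Matrix.det_fin_two`,
`MvPolynomial.eq_of_eval_eq_on_gl`, `Matrix.mvPolynomialX`, `MvPolynomial.IsWeightedHomogeneous` /
`weightedHomogeneousComponent`, `Prime.pow_dvd_of_dvd_mul_left`, `Matrix.adjugate_fin_succ_eq_det_submatrix`,
`Matrix.det_of_upperTriangular`, `finrank_span_le_card`.
-/

noncomputable section

open scoped BigOperators

namespace Literature.Computability.AlgebraicComplexity

namespace IK2020

open TableauEval MvPolynomial
open _root_.Literature.NumberTheory.DiophantineGeometry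

variable (k : ℕ)

/-! ### §0 Conveniences re-derived from `PowerSumWaringRankEquation.lean` -/

/-- Every column has height `≤ m`. [folklore] -/
private theorem hgt_le₂ (c : ℕ) : hgt k c ≤ 2 * k + 4 := by
  unfold hgt; split_ifs <;> omega

/-- Value of the enumeration. [folklore] -/
@[simp] private theorem xEnum_val₂ (i : ℕ) : (xEnum k i : ℕ) = 2 * k + 3 - i := rfl

/-- `x` is an antitone enumeration of `Fin m`. [folklore] -/
private theorem isAntitoneEnum_xEnum₂ : IsAntitoneEnum (xEnum k) (2 * k + 4) where
  anti i j hij hj := by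
    rw [Fin.lt_def, xEnum_val₂, xEnum_val₂]
    omega
  surj v := ⟨2 * k + 3 - v, by omega, Fin.ext (by rw [xEnum_val₂]; omega)⟩

/-- Two boxes with the same column and row numbers are equal. [folklore] -/
private theorem box_ext₂ {n : ℕ} {η : Fin n → ℕ} {b b' : (c : Fin n) × Fin (η c)}
    (h1 : (b.1 : ℕ) = b'.1) (h2 : (b.2 : ℕ) = b'.2) : b = b' := by
  obtain ⟨c, r⟩ := b
  obtain ⟨c', r'⟩ := b'
  obtain rfl : c = c' := Fin.ext h1
  obtain rfl : r = r' := Fin.ext h2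
  rfl

/-- The sorted parts of `ν = (4m, 2m, …, 2m)` (`m ≥ 1`). [cite: IkenmeyerKandasamy2019, Thm. 4.3] -/
private theorem sortedParts_ikPartition₂ {m : ℕ} (hm : 1 ≤ m) :
    (ikPartition m).sortedParts = (4 * m) :: List.replicate (m - 1) (2 * m) := by
  change (ikPartition m).parts.sort (· ≥ ·) = _
  have hparts : (ikPartition m).parts = ↑((4 * m) :: List.replicate (m - 1) (2 * m)) := by
    change Multiset.filter (· ≠ 0) ({4 * m} + Multiset.replicate (m - 1) (2 * m)) = _
    rw [Multiset.filter_eq_self.mpr, Multiset.singleton_add, ← Multiset.coe_replicate,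
      Multiset.cons_coe]
    intro a ha
    simp only [Multiset.mem_add, Multiset.mem_singleton, Multiset.mem_replicate] at ha
    omega
  rw [hparts, Multiset.coe_sort]
  apply List.mergeSort_eq_self
  rw [List.pairwise_cons]
  refine ⟨fun b hb => ?_, List.pairwise_replicate.mpr (Or.inr le_rfl)⟩
  rw [List.mem_replicate] at hb
  omega

/-- The weight `ν^*` at the `i`-th largest variable is `-ν_i`: `-4m` for `i = 0`, `-2m` for
`0 < i < m`. [cite: IkenmeyerKandasamy2019, Thm. 4.3] -/
private theorem dualOfPartition_ikPartition_xEnum₂ (i : ℕ) (hi : i < 2 * k + 4) :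
    Weight.dualOfPartition (2 * k + 4) (ikPartition (2 * k + 4)) (xEnum k i) =
      -((if i = 0 then 8 * k + 16 else 4 * k + 8 : ℕ) : ℤ) := by
  unfold Weight.dualOfPartition Weight.dual Weight.ofPartition
  rw [sortedParts_ikPartition₂ (by omega)]
  have hrev : ((Fin.rev (xEnum k i) : Fin (2 * k + 4)) : ℕ) = i := by
    rw [Fin.val_rev, xEnum_val₂]; omega
  rw [hrev]
  congr 2
  rcases Nat.eq_zero_or_pos i with rfl | hpos
  · rw [List.getD_cons_zero, if_pos rfl]; ring
  · obtain ⟨j, rfl⟩ : ∃ j, i = j + 1 := ⟨i - 1, by omega⟩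
    rw [List.getD_cons_succ, List.getD_eq_getElem _ _ (by rw [List.length_replicate]; omega),
      List.getElem_replicate, if_neg (by omega)]
    omega

/-- The number of columns of height `> i` is `ν_i` (`sh = ν`). [folklore] -/
private theorem card_filter_lt_hgt_fin₂ (i : ℕ) (hi : i < 2 * k + 4) :
    (Finset.univ.filter fun c : Fin (8 * k + 16) => i < hgt k c).card =
      (if i = 0 then 8 * k + 16 else 4 * k + 8 : ℕ) := by
  split_ifs with h0
  · subst h0
    rw [Finset.filter_true_of_mem, Finset.card_univ, Fintype.card_fin]
    intro c _
    unfold hgt; split_ifs <;> omega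
  · have hset : (Finset.univ.filter fun c : Fin (8 * k + 16) => i < hgt k c) =
        Finset.univ.filter fun c : Fin (8 * k + 16) => (c : ℕ) < 4 * k + 8 := by
      apply Finset.filter_congr
      intro c _
      unfold hgt
      constructor
      · intro h; by_contra hc; rw [if_neg hc] at h; omega
      · intro hc; rw [if_pos hc]; omega
    rw [hset, Fin.card_filter_val_lt]
    omega

/-- The coordinate presentation of the power sum: `x₁^m + ⋯ + x_N^m = ∑_j 1 · (e_j)^m`.
[folklore] -/
private theorem psum_eq_splfPoly₂ (N m : ℕ) (K : Type*) [CommRing K] :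
    psum (Fin N) K m =
      splfPoly (fun _ : Fin N => (1 : K)) (fun j (_ : Fin m) => Pi.single j 1) := by
  unfold splfPoly
  rw [psum]
  refine Finset.sum_congr rfl fun j _ => ?_
  rw [C_1, one_mul, Finset.prod_const, Finset.card_univ, Fintype.card_fin, linForm_single]

/-! ### §1 Two tableaux of shape `ν` with content `(2m+2) × m`

Both have the column structure of IK's §12 tableau `T` of `PowerSumWaringRankEquation.lean`
(heights `IK2020.hgt`: `2m` full columns, then `2m` singletons) and the alternators on the
antitone enumeration `IK2020.xEnum` of the variables. Labels: `0, …, m-1` fill the A-block (column `c < m` reads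
`(0, 1, …, m-1)ᵀ`); in `T_A` the B-block columns `m ≤ c < 2m` read `(m, …, 2m-1)ᵀ` and the
singletons carry `2m` (`m` times) then `2m+1` (`m` times); in `T_C` the B-block rows `r ≤ m-3`
carry the constant label `m + r`, row `m-2` reads `β₁ β₂ … β₂`, row `m-1` reads `β₃ … β₃ β₄`
(`β₁, …, β₄ = 2m-2, …, 2m+1`), and the singletons carry the remaining boxes of `β₁, …, β₄`
(`m-1, 1, 1, m-1` of them). -/

/-- Labels of `T_A`. [cite: IkenmeyerKandasamy2019, Thm. 4.3 (first bullet)] -/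
def labA (k c r : ℕ) : ℕ :=
  if c < 2 * k + 4 then r else if c < 4 * k + 8 then 2 * k + 4 + r
  else if c < 6 * k + 12 then 4 * k + 8 else 4 * k + 9

/-- Box indices of `T_A`. [cite: IkenmeyerKandasamy2019, Thm. 4.3 (first bullet)] -/
def idxA (k c _r : ℕ) : ℕ :=
  if c < 2 * k + 4 then c else if c < 4 * k + 8 then c - (2 * k + 4)
  else if c < 6 * k + 12 then c - (4 * k + 8) else c - (6 * k + 12)

/-- Columns of the boxes of `T_A`. [cite: IkenmeyerKandasamy2019, Thm. 4.3 (first bullet)] -/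
def colA (k u s : ℕ) : ℕ :=
  if u < 2 * k + 4 then s else if u < 4 * k + 8 then 2 * k + 4 + s
  else if u = 4 * k + 8 then 4 * k + 8 + s else 6 * k + 12 + s

/-- Rows of the boxes of `T_A`. [cite: IkenmeyerKandasamy2019, Thm. 4.3 (first bullet)] -/
def rowA (k u _s : ℕ) : ℕ :=
  if u < 2 * k + 4 then u else if u < 4 * k + 8 then u - (2 * k + 4) else 0

/-- Labels of `T_C`. [cite: IkenmeyerKandasamy2019, Thm. 4.3 (first bullet)] -/
def labC (k c r : ℕ) : ℕ :=
  if c < 2 * k + 4 then r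
  else if c < 4 * k + 8 then
    (if r < 2 * k + 2 then 2 * k + 4 + r
     else if r = 2 * k + 2 then (if c = 2 * k + 4 then 4 * k + 6 else 4 * k + 7)
     else (if c < 4 * k + 7 then 4 * k + 8 else 4 * k + 9))
  else if c < 6 * k + 11 then 4 * k + 6 else if c = 6 * k + 11 then 4 * k + 7
  else if c = 6 * k + 12 then 4 * k + 8 else 4 * k + 9

/-- Box indices of `T_C`. [cite: IkenmeyerKandasamy2019, Thm. 4.3 (first bullet)] -/
def idxC (k c r : ℕ) : ℕ :=
  if c < 2 * k + 4 then c
  else if c < 4 * k + 8 then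
    (if r < 2 * k + 2 then c - (2 * k + 4)
     else if r = 2 * k + 2 then (if c = 2 * k + 4 then 0 else c - (2 * k + 5))
     else (if c < 4 * k + 7 then c - (2 * k + 4) else 0))
  else if c < 6 * k + 11 then c - (4 * k + 8) + 1 else if c = 6 * k + 11 then 2 * k + 3
  else if c = 6 * k + 12 then 2 * k + 3 else c - (6 * k + 12)

/-- Columns of the boxes of `T_C`. [cite: IkenmeyerKandasamy2019, Thm. 4.3 (first bullet)] -/
def colC (k u s : ℕ) : ℕ :=
  if u < 2 * k + 4 then s
  else if u < 4 * k + 6 then 2 * k + 4 + s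
  else if u = 4 * k + 6 then (if s = 0 then 2 * k + 4 else 4 * k + 7 + s)
  else if u = 4 * k + 7 then (if s < 2 * k + 3 then 2 * k + 5 + s else 6 * k + 11)
  else if u = 4 * k + 8 then (if s < 2 * k + 3 then 2 * k + 4 + s else 6 * k + 12)
  else (if s = 0 then 4 * k + 7 else 6 * k + 12 + s)

/-- Rows of the boxes of `T_C`. [cite: IkenmeyerKandasamy2019, Thm. 4.3 (first bullet)] -/
def rowC (k u s : ℕ) : ℕ :=
  if u < 2 * k + 4 then u
  else if u < 4 * k + 6 then u - (2 * k + 4)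
  else if u = 4 * k + 6 then (if s = 0 then 2 * k + 2 else 0)
  else if u = 4 * k + 7 then (if s < 2 * k + 3 then 2 * k + 2 else 0)
  else if u = 4 * k + 8 then (if s < 2 * k + 3 then 2 * k + 3 else 0)
  else (if s = 0 then 2 * k + 3 else 0)

/-- Columns of `T_A` are `< 8k+16`. [folklore] -/
private theorem colA_lt {u s : ℕ} (_hu : u < 4 * k + 10) (hs : s < 2 * k + 4) :
    colA k u s < 8 * k + 16 := by unfold colA; split_ifs <;> omega
/-- Rows of `T_A` are below the column heights. [folklore] -/
private theorem rowA_lt {u s : ℕ} (_hu : u < 4 * k + 10) (hs : s < 2 * k + 4) :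
    rowA k u s < hgt k (colA k u s) := by unfold rowA hgt colA; split_ifs <;> omega
/-- Labels of `T_A` are `< 4k+10`. [folklore] -/
private theorem labA_lt {c r : ℕ} (hc : c < 8 * k + 16) (hr : r < hgt k c) :
    labA k c r < 4 * k + 10 := by unfold labA; unfold hgt at hr; split_ifs at hr ⊢ <;> omega
/-- Box indices of `T_A` are `< 2k+4`. [folklore] -/
private theorem idxA_lt {c r : ℕ} (hc : c < 8 * k + 16) (_hr : r < hgt k c) :
    idxA k c r < 2 * k + 4 := by unfold idxA; split_ifs <;> omega
/-- `T_A`: label ∘ (col, row) = id. [folklore] -/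
private theorem labA_colA_rowA {u s : ℕ} (hu : u < 4 * k + 10) (hs : s < 2 * k + 4) :
    labA k (colA k u s) (rowA k u s) = u := by
  have key : ∀ c r, colA k u s = c → rowA k u s = r → labA k c r = u := by
    intro c r hc hr; unfold colA at hc; unfold rowA at hr; unfold labA
    split_ifs at hc hr ⊢ <;> omega
  exact key _ _ rfl rfl
/-- `T_A`: index ∘ (col, row) = id. [folklore] -/
private theorem idxA_colA_rowA {u s : ℕ} (_hu : u < 4 * k + 10) (hs : s < 2 * k + 4) :
    idxA k (colA k u s) (rowA k u s) = s := by
  have key : ∀ c r, colA k u s = c → rowA k u s = r → idxA k c r = s := by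
    intro c r hc hr; unfold colA at hc; unfold rowA at hr; unfold idxA
    split_ifs at hc hr ⊢ <;> omega
  exact key _ _ rfl rfl
/-- `T_A`: col ∘ (label, index) = id. [folklore] -/
private theorem colA_labA_idxA {c r : ℕ} (hc : c < 8 * k + 16) (hr : r < hgt k c) :
    colA k (labA k c r) (idxA k c r) = c := by
  have key : ∀ u s, labA k c r = u → idxA k c r = s → colA k u s = c := by
    intro u s hu hs; unfold labA at hu; unfold idxA at hs; unfold colA; unfold hgt at hr
    split_ifs at hu hs hr ⊢ <;> omega
  exact key _ _ rfl rfl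
/-- `T_A`: row ∘ (label, index) = id. [folklore] -/
private theorem rowA_labA_idxA {c r : ℕ} (hc : c < 8 * k + 16) (hr : r < hgt k c) :
    rowA k (labA k c r) (idxA k c r) = r := by
  have key : ∀ u s, labA k c r = u → idxA k c r = s → rowA k u s = r := by
    intro u s hu hs; unfold labA at hu; unfold idxA at hs; unfold rowA; unfold hgt at hr
    split_ifs at hu hs hr ⊢ <;> omega
  exact key _ _ rfl rfl

/-- Columns of `T_C` are `< 8k+16`. [folklore] -/
private theorem colC_lt {u s : ℕ} (_hu : u < 4 * k + 10) (hs : s < 2 * k + 4) :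
    colC k u s < 8 * k + 16 := by unfold colC; split_ifs <;> omega
/-- Rows of `T_C` are below the column heights. [folklore] -/
private theorem rowC_lt {u s : ℕ} (_hu : u < 4 * k + 10) (hs : s < 2 * k + 4) :
    rowC k u s < hgt k (colC k u s) := by unfold rowC hgt colC; split_ifs <;> omega
/-- Labels of `T_C` are `< 4k+10`. [folklore] -/
private theorem labC_lt {c r : ℕ} (hc : c < 8 * k + 16) (hr : r < hgt k c) :
    labC k c r < 4 * k + 10 := by unfold labC; unfold hgt at hr; split_ifs at hr ⊢ <;> omega
/-- Box indices of `T_C` are `< 2k+4`. [folklore] -/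
private theorem idxC_lt {c r : ℕ} (hc : c < 8 * k + 16) (_hr : r < hgt k c) :
    idxC k c r < 2 * k + 4 := by unfold idxC; split_ifs <;> omega
/-- `T_C`: label ∘ (col, row) = id. [folklore] -/
private theorem labC_colC_rowC {u s : ℕ} (hu : u < 4 * k + 10) (hs : s < 2 * k + 4) :
    labC k (colC k u s) (rowC k u s) = u := by
  have key : ∀ c r, colC k u s = c → rowC k u s = r → labC k c r = u := by
    intro c r hc hr; unfold colC at hc; unfold rowC at hr
    split_ifs at hc <;> split_ifs at hr <;> (unfold labC; split_ifs <;> omega)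
  exact key _ _ rfl rfl
/-- `T_C`: index ∘ (col, row) = id. [folklore] -/
private theorem idxC_colC_rowC {u s : ℕ} (_hu : u < 4 * k + 10) (hs : s < 2 * k + 4) :
    idxC k (colC k u s) (rowC k u s) = s := by
  have key : ∀ c r, colC k u s = c → rowC k u s = r → idxC k c r = s := by
    intro c r hc hr; unfold colC at hc; unfold rowC at hr
    split_ifs at hc <;> split_ifs at hr <;> (unfold idxC; split_ifs <;> omega)
  exact key _ _ rfl rfl
set_option maxHeartbeats 400000 in
/-- `T_C`: col ∘ (label, index) = id. [folklore] -/
private theorem colC_labC_idxC {c r : ℕ} (hc : c < 8 * k + 16) (hr : r < hgt k c) :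
    colC k (labC k c r) (idxC k c r) = c := by
  have key : ∀ u s, labC k c r = u → idxC k c r = s → colC k u s = c := by
    intro u s hu hs; unfold hgt at hr; unfold labC at hu; unfold idxC at hs
    split_ifs at hr <;> split_ifs at hu <;> split_ifs at hs <;> (try (exfalso; omega)) <;>
      (unfold colC; split_ifs <;> omega)
  exact key _ _ rfl rfl
/-- `T_C`: row ∘ (label, index) = id. [folklore] -/
private theorem rowC_labC_idxC {c r : ℕ} (hc : c < 8 * k + 16) (hr : r < hgt k c) :
    rowC k (labC k c r) (idxC k c r) = r := by
  have key : ∀ u s, labC k c r = u → idxC k c r = s → rowC k u s = r := by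
    intro u s hu hs; unfold hgt at hr; unfold labC at hu; unfold idxC at hs
    split_ifs at hr <;> split_ifs at hu <;> split_ifs at hs <;> (try (exfalso; omega)) <;>
      (unfold rowC; split_ifs <;> omega)
  exact key _ _ rfl rfl

/-- **The tableau `T_A`** (shape `ν`, content `(2m+2) × m`).
[cite: IkenmeyerKandasamy2019, Thm. 4.3 (first bullet)] -/
def tabA (k : ℕ) : TabM (Fin (2 * k + 4)) where
  C := 8 * k + 16
  d := 4 * k + 10
  m := 2 * k + 4
  h c := hgt k c
  var _ i := xEnum k i
  box u s := ⟨⟨colA k u s, colA_lt k u.2 s.2⟩, ⟨rowA k u s, rowA_lt k u.2 s.2⟩⟩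

/-- **The tableau `T_C`** (shape `ν`, content `(2m+2) × m`).
[cite: IkenmeyerKandasamy2019, Thm. 4.3 (first bullet)] -/
def tabC (k : ℕ) : TabM (Fin (2 * k + 4)) where
  C := 8 * k + 16
  d := 4 * k + 10
  m := 2 * k + 4
  h c := hgt k c
  var _ i := xEnum k i
  box u s := ⟨⟨colC k u s, colC_lt k u.2 s.2⟩, ⟨rowC k u s, rowC_lt k u.2 s.2⟩⟩

/-- The frame of `T_A`. [cite: IkenmeyerKandasamy2019, Thm. 4.3 (first bullet)] -/
def frameA (k : ℕ) : (tabA k).Frame where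
  boxEquiv :=
    { toFun := fun p => (tabA k).box p.1 p.2
      invFun := fun b => (⟨labA k b.1 b.2, labA_lt k b.1.2 b.2.2⟩, ⟨idxA k b.1 b.2, idxA_lt k b.1.2 b.2.2⟩)
      left_inv := fun p => by
        obtain ⟨u, s⟩ := p
        exact Prod.ext (Fin.ext (labA_colA_rowA k u.2 s.2)) (Fin.ext (idxA_colA_rowA k u.2 s.2))
      right_inv := fun b =>
        box_ext₂ (colA_labA_idxA k b.1.2 b.2.2) (rowA_labA_idxA k b.1.2 b.2.2) }
  box_eq _ _ := rfl

/-- The frame of `T_C`. [cite: IkenmeyerKandasamy2019, Thm. 4.3 (first bullet)] -/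
def frameC (k : ℕ) : (tabC k).Frame where
  boxEquiv :=
    { toFun := fun p => (tabC k).box p.1 p.2
      invFun := fun b => (⟨labC k b.1 b.2, labC_lt k b.1.2 b.2.2⟩, ⟨idxC k b.1 b.2, idxC_lt k b.1.2 b.2.2⟩)
      left_inv := fun p => by
        obtain ⟨u, s⟩ := p
        exact Prod.ext (Fin.ext (labC_colC_rowC k u.2 s.2)) (Fin.ext (idxC_colC_rowC k u.2 s.2))
      right_inv := fun b =>
        box_ext₂ (colC_labC_idxC k b.1.2 b.2.2) (rowC_labC_idxC k b.1.2 b.2.2) }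
  box_eq _ _ := rfl

/-- The tableau polynomial `F_A` of `T_A`. [cite: IkenmeyerKandasamy2019, Thm. 4.3 (first bullet)] -/
def polyA (k : ℕ) : MvPolynomial (DegIdx (Fin (2 * k + 4)) (2 * k + 4)) ℂ := (tabA k).tabPoly ℂ

/-- The tableau polynomial `F_C` of `T_C`. [cite: IkenmeyerKandasamy2019, Thm. 4.3 (first bullet)] -/
def polyC (k : ℕ) : MvPolynomial (DegIdx (Fin (2 * k + 4)) (2 * k + 4)) ℂ := (tabC k).tabPoly ℂ

/-- `F_A` is a highest-weight vector of weight `ν^*`. [cite: IkenmeyerKandasamy2019, Thm. 11.1] -/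
theorem polyA_mem_highestWeightSpace :
    polyA k ∈ highestWeightSpace (coordRep (Fin (2 * k + 4)) ℂ (2 * k + 4))
      (Weight.dualOfPartition (2 * k + 4) (ikPartition (2 * k + 4))) := by
  refine (tabA k).tabPoly_mem_highestWeightSpace (frameA k) (isAntitoneEnum_xEnum₂ k)
    (fun c => hgt_le₂ k _) (fun c r => rfl) _ (fun i hi => ?_)
  show _ = -((Finset.univ.filter fun c : Fin (8 * k + 16) => i < hgt k c).card : ℤ)
  rw [dualOfPartition_ikPartition_xEnum₂ k i hi, card_filter_lt_hgt_fin₂ k i hi]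

/-- `F_C` is a highest-weight vector of weight `ν^*`. [cite: IkenmeyerKandasamy2019, Thm. 11.1] -/
theorem polyC_mem_highestWeightSpace :
    polyC k ∈ highestWeightSpace (coordRep (Fin (2 * k + 4)) ℂ (2 * k + 4))
      (Weight.dualOfPartition (2 * k + 4) (ikPartition (2 * k + 4))) := by
  refine (tabC k).tabPoly_mem_highestWeightSpace (frameC k) (isAntitoneEnum_xEnum₂ k)
    (fun c => hgt_le₂ k _) (fun c r => rfl) _ (fun i hi => ?_)
  show _ = -((Finset.univ.filter fun c : Fin (8 * k + 16) => i < hgt k c).card : ℤ)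
  rw [dualOfPartition_ikPartition_xEnum₂ k i hi, card_filter_lt_hgt_fin₂ k i hi]

/-! ### §2 Values of tableau polynomials at the points `A · p` -/

/-- **Value of a framed tableau polynomial at `A · p = ∑_j (A e_j)^m`** (general form of
`aeval_linSubst_psum_ikPoly`): `(m!)^d ∑_φ ∏_c det (A_{var c i, φ(label(c,r))})_{i,r}` — IK
Thm. 11.1's `γ(A M_{δ,m} T)`. [cite: IkenmeyerKandasamy2019, Thm. 11.1] -/
theorem aeval_linSubst_psum_tabPoly {N : ℕ} (τ : TabM (Fin N)) (F : τ.Frame)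
    (A : Matrix (Fin N) (Fin N) ℂ) :
    aeval (formCoeff τ.m (linSubst (Fin N) ℂ A (psum (Fin N) ℂ τ.m))) (τ.tabPoly ℂ) =
      ((τ.m.factorial : ℂ)) ^ τ.d * ∑ φ : Fin τ.d → Fin N,
        ∏ c, (Matrix.of fun i r : Fin (τ.h c) =>
          A (τ.var c i) (φ (F.boxEquiv.symm ⟨c, r⟩).1)).det := by
  rw [psum_eq_splfPoly₂, linSubst_splfPoly]
  have hmap : mapForms A (fun (j : Fin N) (_ : Fin τ.m) => (Pi.single j (1 : ℂ))) =
      fun j _ => A.col j := by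
    funext j s
    simp only [mapForms, Matrix.mulVec_single_one]
  rw [hmap, τ.aeval_formCoeff_tabPoly, τ.EC_powers F]
  simp only [Finset.prod_const_one, one_mul]
  rfl

/-- The `m × m` determinant `det (A_{x_i, w(r)})_{i,r}` of a full column whose labels go to `w`.
[cite: IkenmeyerKandasamy2019, Thm. 11.1] -/
def fullDet (A : Matrix (Fin (2 * k + 4)) (Fin (2 * k + 4)) ℂ)
    (w : Fin (2 * k + 4) → Fin (2 * k + 4)) : ℂ :=
  (Matrix.of fun i r : Fin (2 * k + 4) => A (xEnum k i) (w r)).det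

/-- A repeated value kills the column determinant (two equal columns). [folklore] -/
private theorem fullDet_eq_zero_of_not_injective {A : Matrix (Fin (2 * k + 4)) (Fin (2 * k + 4)) ℂ}
    {w : Fin (2 * k + 4) → Fin (2 * k + 4)} (hw : ¬ Function.Injective w) : fullDet k A w = 0 := by
  obtain ⟨r, r', heq, hne⟩ := Function.not_injective_iff.mp hw
  exact Matrix.det_zero_of_column_eq hne fun i => by simp only [Matrix.of_apply, heq]

/-- On `Fin m` the enumeration `x` is `Fin.rev`. [folklore] -/
private theorem xEnum_fin (i : Fin (2 * k + 4)) : xEnum k i = Fin.rev i := by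
  apply Fin.ext
  rw [xEnum_val₂, Fin.val_rev]
  omega

/-- For injective (= bijective) `w` the column determinant is `± det A`. [folklore] -/
private theorem fullDet_sq_of_injective {A : Matrix (Fin (2 * k + 4)) (Fin (2 * k + 4)) ℂ}
    {w : Fin (2 * k + 4) → Fin (2 * k + 4)} (hw : Function.Injective w) :
    fullDet k A w ^ 2 = A.det ^ 2 := by
  have hbij : Function.Bijective w := Finite.injective_iff_bijective.mp hw
  set e : Equiv.Perm (Fin (2 * k + 4)) := Equiv.ofBijective w hbij with he
  have hM : (Matrix.of fun i r : Fin (2 * k + 4) => A (xEnum k i) (w r)) =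
      (A.submatrix id e).submatrix Fin.revPerm id := by
    ext i r
    simp only [Matrix.submatrix_apply, Matrix.of_apply, id, xEnum_fin, Fin.revPerm_apply, he,
      Equiv.ofBijective_apply]
  unfold fullDet
  rw [hM, Matrix.det_permute, Matrix.det_permute']
  rcases Int.units_eq_one_or (Equiv.Perm.sign (Fin.revPerm : Equiv.Perm (Fin (2 * k + 4))))
    with h1 | h1 <;>
  rcases Int.units_eq_one_or (Equiv.Perm.sign e) with h2 | h2 <;>
  · rw [h1, h2]; push_cast; ring

/-- `det (column)^m ∈ {0, 1}` when `det A = 1` (`m = 2k+4` is even): `1` iff the labels of the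
column receive distinct values. [folklore] -/
private theorem fullDet_pow_eq {A : Matrix (Fin (2 * k + 4)) (Fin (2 * k + 4)) ℂ} (hA : A.det = 1)
    (w : Fin (2 * k + 4) → Fin (2 * k + 4)) [Decidable (Function.Injective w)] :
    fullDet k A w ^ (2 * k + 4) = if Function.Injective w then 1 else 0 := by
  split_ifs with hw
  · rw [show 2 * k + 4 = 2 * (k + 2) by ring, pow_mul, fullDet_sq_of_injective k hw, hA, one_pow,
      one_pow]
  · rw [fullDet_eq_zero_of_not_injective k hw, zero_pow (by omega)]

/-- The largest variable `x_0 = m - 1` ("top"). [folklore] -/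
def topIdx (k : ℕ) : Fin (2 * k + 4) := ⟨2 * k + 3, by omega⟩

/-- The variable `0` ("bottom"). [folklore] -/
def botIdx (k : ℕ) : Fin (2 * k + 4) := ⟨0, by omega⟩

/-- `top ≠ bot`. [folklore] -/
private theorem topIdx_ne_botIdx : topIdx k ≠ botIdx k := by
  simp [topIdx, botIdx, Fin.ext_iff]

/-- The largest variable is `top`. [folklore] -/
private theorem xEnum_zero : xEnum k 0 = topIdx k := Fin.ext (by simp [topIdx])

/-- The second evaluation point's matrix `A′ = 1 + E_{top,bottom}` (a transvection).
[cite: IkenmeyerKandasamy2019, Thm. 4.3 (first bullet)] -/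
def matT (k : ℕ) : Matrix (Fin (2 * k + 4)) (Fin (2 * k + 4)) ℂ :=
  Matrix.transvection (topIdx k) (botIdx k) 1

/-- `det A′ = 1`. [folklore] -/
private theorem det_matT : (matT k).det = 1 :=
  Matrix.det_transvection_of_ne (topIdx k) (botIdx k) (topIdx_ne_botIdx k) 1

/-- Row `top` of `A′` is the indicator of `{top, bottom}`. [folklore] -/
private theorem matT_top_apply (y : Fin (2 * k + 4)) :
    matT k (topIdx k) y = if y = topIdx k ∨ y = botIdx k then 1 else 0 := by
  unfold matT Matrix.transvection
  rw [Matrix.add_apply, Matrix.one_apply, Matrix.single_apply]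
  have hne := topIdx_ne_botIdx k
  by_cases h1 : y = topIdx k
  · subst h1; simp [hne.symm]
  · by_cases h2 : y = botIdx k
    · subst h2; simp [hne, h1]
    · simp [h1, h2, Ne.symm h1, Ne.symm h2]

/-- Row `top` of `1` is the indicator of `{top}`. [folklore] -/
private theorem one_top_apply (y : Fin (2 * k + 4)) :
    (1 : Matrix (Fin (2 * k + 4)) (Fin (2 * k + 4)) ℂ) (topIdx k) y =
      if y = topIdx k then 1 else 0 := by
  rw [Matrix.one_apply]
  simp only [eq_comm]

/-! ### §3 The evaluation matrix of `(F_A, F_C)` at `(p, A′ · p)` is triangular and nonsingular -/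

/-- A relabelling `φ` of the `2m+2` labels by variables, extended to all naturals
(junk `bottom` beyond). [folklore] -/
def extF (φ : Fin (4 * k + 10) → Fin (2 * k + 4)) (u : ℕ) : Fin (2 * k + 4) :=
  if h : u < 4 * k + 10 then φ ⟨u, h⟩ else botIdx k

/-- `extF` agrees with `φ` on labels `< 4k+10`. [folklore] -/
private theorem extF_of_lt (φ : Fin (4 * k + 10) → Fin (2 * k + 4)) {u : ℕ} (hu : u < 4 * k + 10) :
    extF k φ u = φ ⟨u, hu⟩ := by
  unfold extF; rw [dif_pos hu]

/-- The column determinant of height `n` with label function `g`, at `A`, under `φ`.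
[folklore] -/
def colVal (A : Matrix (Fin (2 * k + 4)) (Fin (2 * k + 4)) ℂ) (φ : Fin (4 * k + 10) → Fin (2 * k + 4))
    (n : ℕ) (g : ℕ → ℕ) : ℂ :=
  (Matrix.of fun i r : Fin n => A (xEnum k i) (extF k φ (g r))).det

/-- A full column (`c < 2m`) contributes `fullDet`. [folklore] -/
private theorem colVal_full (A : Matrix (Fin (2 * k + 4)) (Fin (2 * k + 4)) ℂ)
    (φ : Fin (4 * k + 10) → Fin (2 * k + 4)) {c : ℕ} (hc : c < 4 * k + 8) (g : ℕ → ℕ) :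
    colVal k A φ (hgt k c) g = fullDet k A fun r => extF k φ (g r) := by
  have h : hgt k c = 2 * k + 4 := by unfold hgt; rw [if_pos hc]
  unfold colVal fullDet
  rw [h]

/-- A singleton column (`c ≥ 2m`) contributes the entry `A_{top, φ(label)}`. [folklore] -/
private theorem colVal_single (A : Matrix (Fin (2 * k + 4)) (Fin (2 * k + 4)) ℂ)
    (φ : Fin (4 * k + 10) → Fin (2 * k + 4)) {c : ℕ} (hc : ¬ c < 4 * k + 8) (g : ℕ → ℕ) :
    colVal k A φ (hgt k c) g = A (topIdx k) (extF k φ (g 0)) := by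
  have h : hgt k c = 1 := by unfold hgt; rw [if_neg hc]
  unfold colVal
  rw [h, Matrix.det_fin_one, Matrix.of_apply, ← xEnum_zero]
  rfl

/-- Splitting the product over the `4m` columns into the A-block, the B-block and the
singletons. [folklore] -/
private theorem prod_cols_split (W : ℕ → ℂ) :
    ∏ c : Fin (8 * k + 16), W c =
      (∏ c ∈ Finset.range (2 * k + 4), W c) * (∏ j ∈ Finset.range (2 * k + 4), W (2 * k + 4 + j)) *
        ∏ t ∈ Finset.range (4 * k + 8), W (4 * k + 8 + t) := by
  rw [Fin.prod_univ_eq_prod_range W (8 * k + 16), show 8 * k + 16 = (4 * k + 8) + (4 * k + 8) by ring,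
    Finset.prod_range_add, show 4 * k + 8 = (2 * k + 4) + (2 * k + 4) by ring, Finset.prod_range_add]

section Terms

open Classical in
/-- `det (column)^m ∈ {0, 1}` when `det A = 1` (`m = 2k+4` is even): `1` iff the labels of the
column receive distinct values. [folklore] -/
private theorem fullDet_pow_ite {A : Matrix (Fin (2 * k + 4)) (Fin (2 * k + 4)) ℂ} (hA : A.det = 1)
    (w : Fin (2 * k + 4) → Fin (2 * k + 4)) :
    fullDet k A w ^ (2 * k + 4) = if Function.Injective w then 1 else 0 :=
  fullDet_pow_eq k hA w

/-- The A-block value function `r ↦ φ(r)`. [folklore] -/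
def wA (φ : Fin (4 * k + 10) → Fin (2 * k + 4)) (r : Fin (2 * k + 4)) : Fin (2 * k + 4) :=
  extF k φ r

/-- The B-block value function of `T_A`: `r ↦ φ(m + r)`. [folklore] -/
def wB (φ : Fin (4 * k + 10) → Fin (2 * k + 4)) (r : Fin (2 * k + 4)) : Fin (2 * k + 4) :=
  extF k φ (2 * k + 4 + r)

/-- The `j`-th B-block value function of `T_C`. [folklore] -/
def wC (φ : Fin (4 * k + 10) → Fin (2 * k + 4)) (j : ℕ) (r : Fin (2 * k + 4)) : Fin (2 * k + 4) :=
  extF k φ (labC k (2 * k + 4 + j) r)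

/-- **The term of `φ` in `F_A(A · p)`**: `(det A-column)^m (det B-column)^m ∏ (singleton entries)`.
[cite: IkenmeyerKandasamy2019, Thm. 11.1] -/
private theorem termA_eq (A : Matrix (Fin (2 * k + 4)) (Fin (2 * k + 4)) ℂ)
    (φ : Fin (4 * k + 10) → Fin (2 * k + 4)) :
    ∏ c : Fin (8 * k + 16), colVal k A φ (hgt k c) (labA k c) =
      fullDet k A (wA k φ) ^ (2 * k + 4) * fullDet k A (wB k φ) ^ (2 * k + 4) *
        ∏ t ∈ Finset.range (4 * k + 8), A (topIdx k) (extF k φ (labA k (4 * k + 8 + t) 0)) := by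
  rw [prod_cols_split k (fun c => colVal k A φ (hgt k c) (labA k c))]
  congr 1
  · congr 1
    · rw [Finset.prod_congr rfl fun c hc => ?_, Finset.prod_const, Finset.card_range]
      rw [Finset.mem_range] at hc
      rw [colVal_full k A φ (by omega)]
      congr 1; funext r; unfold wA labA; rw [if_pos hc]
    · rw [Finset.prod_congr rfl fun j hj => ?_, Finset.prod_const, Finset.card_range]
      rw [Finset.mem_range] at hj
      rw [colVal_full k A φ (by omega)]
      congr 1; funext r; unfold wB labA; rw [if_neg (by omega), if_pos (by omega)]
  · refine Finset.prod_congr rfl fun t ht => ?_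
    rw [Finset.mem_range] at ht
    exact colVal_single k A φ (by omega) _

/-- **The term of `φ` in `F_C(A · p)`**. [cite: IkenmeyerKandasamy2019, Thm. 11.1] -/
private theorem termC_eq (A : Matrix (Fin (2 * k + 4)) (Fin (2 * k + 4)) ℂ)
    (φ : Fin (4 * k + 10) → Fin (2 * k + 4)) :
    ∏ c : Fin (8 * k + 16), colVal k A φ (hgt k c) (labC k c) =
      fullDet k A (wA k φ) ^ (2 * k + 4) * (∏ j ∈ Finset.range (2 * k + 4), fullDet k A (wC k φ j)) *
        ∏ t ∈ Finset.range (4 * k + 8), A (topIdx k) (extF k φ (labC k (4 * k + 8 + t) 0)) := by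
  rw [prod_cols_split k (fun c => colVal k A φ (hgt k c) (labC k c))]
  congr 1
  · congr 1
    · rw [Finset.prod_congr rfl fun c hc => ?_, Finset.prod_const, Finset.card_range]
      rw [Finset.mem_range] at hc
      rw [colVal_full k A φ (by omega)]
      congr 1; funext r; unfold wA labC; rw [if_pos hc]
    · refine Finset.prod_congr rfl fun j hj => ?_
      rw [Finset.mem_range] at hj
      rw [colVal_full k A φ (by omega)]
      rfl
  · refine Finset.prod_congr rfl fun t ht => ?_
    rw [Finset.mem_range] at ht
    exact colVal_single k A φ (by omega) _

/-- The bridge from the frame of `T_A` to `colVal`. [folklore] -/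
private theorem det_col_tabA (A : Matrix (Fin (2 * k + 4)) (Fin (2 * k + 4)) ℂ)
    (φ : Fin (4 * k + 10) → Fin (2 * k + 4)) (c : Fin (tabA k).C) :
    (Matrix.of fun i r : Fin ((tabA k).h c) =>
        A ((tabA k).var c i) (φ ((frameA k).boxEquiv.symm ⟨c, r⟩).1)).det =
      colVal k A φ (hgt k c) (labA k c) := by
  unfold colVal
  congr 1
  ext i r
  simp only [Matrix.of_apply]
  rw [extF_of_lt k φ (labA_lt k c.2 r.2)]
  rfl

/-- The bridge from the frame of `T_C` to `colVal`. [folklore] -/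
private theorem det_col_tabC (A : Matrix (Fin (2 * k + 4)) (Fin (2 * k + 4)) ℂ)
    (φ : Fin (4 * k + 10) → Fin (2 * k + 4)) (c : Fin (tabC k).C) :
    (Matrix.of fun i r : Fin ((tabC k).h c) =>
        A ((tabC k).var c i) (φ ((frameC k).boxEquiv.symm ⟨c, r⟩).1)).det =
      colVal k A φ (hgt k c) (labC k c) := by
  unfold colVal
  congr 1
  ext i r
  simp only [Matrix.of_apply]
  rw [extF_of_lt k φ (labC_lt k c.2 r.2)]
  rfl

/-- **`F_A(A · p)` and `F_C(A · p)` as sums of column-determinant terms.**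
[cite: IkenmeyerKandasamy2019, Thm. 11.1] -/
theorem aeval_polyA (A : Matrix (Fin (2 * k + 4)) (Fin (2 * k + 4)) ℂ) :
    aeval (formCoeff (2 * k + 4)
        (linSubst (Fin (2 * k + 4)) ℂ A (psum (Fin (2 * k + 4)) ℂ (2 * k + 4)))) (polyA k) =
      ((2 * k + 4).factorial : ℂ) ^ (4 * k + 10) * ∑ φ : Fin (4 * k + 10) → Fin (2 * k + 4),
        ∏ c : Fin (8 * k + 16), colVal k A φ (hgt k c) (labA k c) := by
  refine (aeval_linSubst_psum_tabPoly (tabA k) (frameA k) A).trans ?_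
  simp only [det_col_tabA]
  rfl

/-- **`F_C(A · p)` as a sum over relabellings** (Thm. 11.1's evaluation formula for `T_C`). [folklore] -/
private theorem aeval_polyC (A : Matrix (Fin (2 * k + 4)) (Fin (2 * k + 4)) ℂ) :
    aeval (formCoeff (2 * k + 4)
        (linSubst (Fin (2 * k + 4)) ℂ A (psum (Fin (2 * k + 4)) ℂ (2 * k + 4)))) (polyC k) =
      ((2 * k + 4).factorial : ℂ) ^ (4 * k + 10) * ∑ φ : Fin (4 * k + 10) → Fin (2 * k + 4),
        ∏ c : Fin (8 * k + 16), colVal k A φ (hgt k c) (labC k c) := by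
  refine (aeval_linSubst_psum_tabPoly (tabC k) (frameC k) A).trans ?_
  simp only [det_col_tabC]
  rfl

end Terms

section Values

open Classical

/-- Singleton factors at `1`: the indicator of "every singleton label goes to `top`". [folklore] -/
private theorem prod_single_one (φ : Fin (4 * k + 10) → Fin (2 * k + 4)) (lab : ℕ → ℕ → ℕ) :
    ∏ t ∈ Finset.range (4 * k + 8),
        (1 : Matrix (Fin (2 * k + 4)) (Fin (2 * k + 4)) ℂ) (topIdx k) (extF k φ (lab (4 * k + 8 + t) 0)) =
      if ∀ t < 4 * k + 8, extF k φ (lab (4 * k + 8 + t) 0) = topIdx k then 1 else 0 := by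
  simp only [one_top_apply, Finset.prod_boole, Finset.mem_range]

/-- Singleton factors at `A′`: the indicator of "every singleton label goes to `top` or `bottom`".
[folklore] -/
private theorem prod_single_matT (φ : Fin (4 * k + 10) → Fin (2 * k + 4)) (lab : ℕ → ℕ → ℕ) :
    ∏ t ∈ Finset.range (4 * k + 8), matT k (topIdx k) (extF k φ (lab (4 * k + 8 + t) 0)) =
      if ∀ t < 4 * k + 8, (extF k φ (lab (4 * k + 8 + t) 0) = topIdx k ∨
        extF k φ (lab (4 * k + 8 + t) 0) = botIdx k) then 1 else 0 := by
  simp only [matT_top_apply, Finset.prod_boole, Finset.mem_range]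

/-- Good relabellings for `T_A` at the point `p`. [folklore] -/
private def GoodA (φ : Fin (4 * k + 10) → Fin (2 * k + 4)) : Prop :=
  Function.Injective (wA k φ) ∧ Function.Injective (wB k φ) ∧
    ∀ t < 4 * k + 8, extF k φ (labA k (4 * k + 8 + t) 0) = topIdx k

/-- **Every term of `F_A(p)` is `0` or `1`, and it is `1` exactly for the good relabellings.**
[cite: IkenmeyerKandasamy2019, Thm. 4.3 (first bullet)] -/
private theorem termA_one (φ : Fin (4 * k + 10) → Fin (2 * k + 4)) :
    ∏ c : Fin (8 * k + 16), colVal k 1 φ (hgt k c) (labA k c) = if GoodA k φ then 1 else 0 := by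
  rw [termA_eq, fullDet_pow_ite k Matrix.det_one, fullDet_pow_ite k Matrix.det_one, prod_single_one]
  unfold GoodA
  by_cases h1 : Function.Injective (wA k φ) <;> by_cases h2 : Function.Injective (wB k φ) <;>
    by_cases h3 : (∀ t < 4 * k + 8, extF k φ (labA k (4 * k + 8 + t) 0) = topIdx k) <;>
    simp [h1, h2, h3]

/-- The B-block labels of `T_C` in closed form. [folklore] -/
private theorem labC_B {j : ℕ} (hj : j < 2 * k + 4) (r : ℕ) :
    labC k (2 * k + 4 + j) r =
      if r < 2 * k + 2 then 2 * k + 4 + r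
      else if r = 2 * k + 2 then (if j = 0 then 4 * k + 6 else 4 * k + 7)
      else (if j < 2 * k + 3 then 4 * k + 8 else 4 * k + 9) := by
  unfold labC; split_ifs <;> omega

/-- The singleton labels of `T_C` in closed form. [folklore] -/
private theorem labC_S {t : ℕ} (ht : t < 4 * k + 8) :
    labC k (4 * k + 8 + t) 0 =
      if t < 2 * k + 3 then 4 * k + 6 else if t = 2 * k + 3 then 4 * k + 7
      else if t = 2 * k + 4 then 4 * k + 8 else 4 * k + 9 := by
  unfold labC; split_ifs <;> omega

/-- The B-block value functions of `T_C` in closed form. [folklore] -/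
private theorem wC_mk (φ : Fin (4 * k + 10) → Fin (2 * k + 4)) {j r : ℕ} (hj : j < 2 * k + 4)
    (hr : r < 2 * k + 4) :
    wC k φ j ⟨r, hr⟩ = extF k φ
      (if r < 2 * k + 2 then 2 * k + 4 + r
       else if r = 2 * k + 2 then (if j = 0 then 4 * k + 6 else 4 * k + 7)
       else (if j < 2 * k + 3 then 4 * k + 8 else 4 * k + 9)) := by
  show extF k φ (labC k (2 * k + 4 + j) r) = _
  rw [labC_B k hj]

/-- The B-block value of `T_C` in the row `m - 2`. [folklore] -/
private theorem wC_row2 (φ : Fin (4 * k + 10) → Fin (2 * k + 4)) {j : ℕ} (hj : j < 2 * k + 4) :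
    wC k φ j ⟨2 * k + 2, by omega⟩ = extF k φ (if j = 0 then 4 * k + 6 else 4 * k + 7) := by
  rw [wC_mk k φ hj, if_neg (by omega), if_pos rfl]

/-- The B-block value of `T_C` in the row `m - 1`. [folklore] -/
private theorem wC_row3 (φ : Fin (4 * k + 10) → Fin (2 * k + 4)) {j : ℕ} (hj : j < 2 * k + 4) :
    wC k φ j ⟨2 * k + 3, by omega⟩ = extF k φ (if j < 2 * k + 3 then 4 * k + 8 else 4 * k + 9) := by
  rw [wC_mk k φ hj, if_neg (by omega), if_neg (by omega)]

/-- The index of `top`. [folklore] -/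
@[simp] private theorem topIdx_val : ((topIdx k : Fin (2 * k + 4)) : ℕ) = 2 * k + 3 := rfl

/-- The index of `bot`. [folklore] -/
@[simp] private theorem botIdx_val : ((botIdx k : Fin (2 * k + 4)) : ℕ) = 0 := rfl

/-- **Every term of `F_C(p)` vanishes**: if all singleton labels go to `top`, the first B-column
carries `β₁` and `β₃`, both sent to `top`. [cite: IkenmeyerKandasamy2019, Thm. 4.3 (first bullet)] -/
private theorem termC_one (φ : Fin (4 * k + 10) → Fin (2 * k + 4)) :
    ∏ c : Fin (8 * k + 16), colVal k 1 φ (hgt k c) (labC k c) = 0 := by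
  rw [termC_eq, prod_single_one]
  split_ifs with h
  · -- all singleton labels go to `top`; then column `j = 0` of the B-block repeats `top`
    have h6 : extF k φ (4 * k + 6) = topIdx k := by
      have := h 0 (by omega); rwa [labC_S k (by omega), if_pos (by omega)] at this
    have h8 : extF k φ (4 * k + 8) = topIdx k := by
      have := h (2 * k + 4) (by omega)
      rwa [labC_S k (by omega), if_neg (by omega), if_neg (by omega), if_pos rfl] at this
    have hnot : ¬ Function.Injective (wC k φ 0) := by
      intro hinj
      have heq : wC k φ 0 ⟨2 * k + 2, by omega⟩ = wC k φ 0 ⟨2 * k + 3, by omega⟩ := by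
        rw [wC_row2 k φ (by omega), wC_row3 k φ (by omega), if_pos rfl, if_pos (by omega), h6, h8]
      have := Fin.mk.inj_iff.mp (hinj heq)
      omega
    rw [Finset.prod_eq_zero (Finset.mem_range.mpr (show 0 < 2 * k + 4 by omega))
      (fullDet_eq_zero_of_not_injective k hnot)]
    simp
  · simp

/-- Good relabellings for `T_C` at the point `A′ · p`. [folklore] -/
private def GoodC (φ : Fin (4 * k + 10) → Fin (2 * k + 4)) : Prop :=
  Function.Injective (wA k φ) ∧ (∀ j < 2 * k + 4, Function.Injective (wC k φ j)) ∧
    ∀ t < 4 * k + 8, (extF k φ (labC k (4 * k + 8 + t) 0) = topIdx k ∨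
      extF k φ (labC k (4 * k + 8 + t) 0) = botIdx k)

/-- In a two-element set, two elements different from a third one are equal. [folklore] -/
private theorem eq_of_ne_of_ne {α : Type*} {p q x y z : α} (hx : x = p ∨ x = q) (hy : y = p ∨ y = q)
    (hz : z = p ∨ z = q) (hxz : x ≠ z) (hyz : y ≠ z) : x = y := by
  rcases hz with hz | hz
  · rcases hx with hx | hx
    · exact absurd (hx.trans hz.symm) hxz
    rcases hy with hy | hy
    · exact absurd (hy.trans hz.symm) hyz
    exact hx.trans hy.symm
  · rcases hx with hx | hx
    · rcases hy with hy | hy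
      · exact hx.trans hy.symm
      exact absurd (hy.trans hz.symm) hyz
    exact absurd (hx.trans hz.symm) hxz

/-- **The forced coloring.** If every singleton label of `T_C` goes to `top` or `bottom` and every
B-column receives distinct values, then `φ(β₁) = φ(β₂)`, `φ(β₃) = φ(β₄)`, so all B-columns
receive the SAME values. [cite: IkenmeyerKandasamy2019, Thm. 4.3 (first bullet)] -/
private theorem wC_eq_wC_zero (φ : Fin (4 * k + 10) → Fin (2 * k + 4))
    (hS : ∀ t < 4 * k + 8, (extF k φ (labC k (4 * k + 8 + t) 0) = topIdx k ∨
      extF k φ (labC k (4 * k + 8 + t) 0) = botIdx k))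
    (hI : ∀ j < 2 * k + 4, Function.Injective (wC k φ j)) {j : ℕ} (hj : j < 2 * k + 4) :
    wC k φ j = wC k φ 0 := by
  -- the four special values lie in `{top, bot}`
  have a1 := hS 0 (by omega)
  rw [labC_S k (by omega), if_pos (by omega)] at a1
  have a2 := hS (2 * k + 3) (by omega)
  rw [labC_S k (by omega), if_neg (by omega), if_pos rfl] at a2
  have a3 := hS (2 * k + 4) (by omega)
  rw [labC_S k (by omega), if_neg (by omega), if_neg (by omega), if_pos rfl] at a3
  have a4 := hS (2 * k + 5) (by omega)
  rw [labC_S k (by omega), if_neg (by omega), if_neg (by omega), if_neg (by omega)] at a4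
  -- injectivity of the columns `j = 0, 1, m - 1` in the last two rows
  have key : ∀ j' < 2 * k + 4, extF k φ (if j' = 0 then 4 * k + 6 else 4 * k + 7) ≠
      extF k φ (if j' < 2 * k + 3 then 4 * k + 8 else 4 * k + 9) := by
    intro j' hj' h
    have h2 : wC k φ j' ⟨2 * k + 2, by omega⟩ = wC k φ j' ⟨2 * k + 3, by omega⟩ := by
      rw [wC_row2 k φ hj', wC_row3 k φ hj', h]
    have := Fin.mk.inj_iff.mp (hI j' hj' h2)
    omega
  have ne13 : extF k φ (4 * k + 6) ≠ extF k φ (4 * k + 8) := by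
    have := key 0 (by omega); rwa [if_pos rfl, if_pos (by omega)] at this
  have ne23 : extF k φ (4 * k + 7) ≠ extF k φ (4 * k + 8) := by
    have := key 1 (by omega); rwa [if_neg (by omega), if_pos (by omega)] at this
  have ne24 : extF k φ (4 * k + 7) ≠ extF k φ (4 * k + 9) := by
    have := key (2 * k + 3) (by omega); rwa [if_neg (by omega), if_neg (by omega)] at this
  have e12 : extF k φ (4 * k + 6) = extF k φ (4 * k + 7) := eq_of_ne_of_ne a1 a2 a3 ne13 ne23
  have e34 : extF k φ (4 * k + 8) = extF k φ (4 * k + 9) :=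
    eq_of_ne_of_ne a3 a4 a2 ne23.symm ne24.symm
  -- conclude
  funext ⟨r, hr⟩
  rw [wC_mk k φ hj hr, wC_mk k φ (show 0 < 2 * k + 4 by omega) hr]
  split_ifs <;> first | rfl | exact e12.symm | exact e34.symm | omega

/-- **Every term of `F_C(A′ · p)` is `0` or `1`, and it is `1` exactly for the good relabellings.**
[cite: IkenmeyerKandasamy2019, Thm. 4.3 (first bullet)] -/
private theorem termC_matT (φ : Fin (4 * k + 10) → Fin (2 * k + 4)) :
    ∏ c : Fin (8 * k + 16), colVal k (matT k) φ (hgt k c) (labC k c) = if GoodC k φ then 1 else 0 := by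
  rw [termC_eq, fullDet_pow_ite k (det_matT k), prod_single_matT]
  unfold GoodC
  by_cases hS : ∀ t < 4 * k + 8, (extF k φ (labC k (4 * k + 8 + t) 0) = topIdx k ∨
      extF k φ (labC k (4 * k + 8 + t) 0) = botIdx k)
  · by_cases hI : ∀ j < 2 * k + 4, Function.Injective (wC k φ j)
    · have hB : ∏ j ∈ Finset.range (2 * k + 4), fullDet k (matT k) (wC k φ j) = 1 := by
        rw [Finset.prod_congr rfl fun j hj => by rw [wC_eq_wC_zero k φ hS hI (Finset.mem_range.mp hj)],
          Finset.prod_const, Finset.card_range, fullDet_pow_ite k (det_matT k), if_pos (hI 0 (by omega))]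
      rw [hB, if_pos hS]
      by_cases h1 : Function.Injective (wA k φ)
      · rw [if_pos h1, if_pos ⟨h1, hI, hS⟩]; ring
      · rw [if_neg h1, if_neg (show ¬ (Function.Injective (wA k φ) ∧ _) from fun h => h1 h.1)]; ring
    · obtain ⟨j, hj, hnot⟩ : ∃ j, j < 2 * k + 4 ∧ ¬ Function.Injective (wC k φ j) := by
        simpa using hI
      rw [Finset.prod_eq_zero (Finset.mem_range.mpr hj) (fullDet_eq_zero_of_not_injective k hnot),
        if_neg (show ¬ (Function.Injective (wA k φ) ∧ _) from fun h => hI h.2.1)]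
      ring
  · rw [if_neg hS, if_neg (show ¬ (Function.Injective (wA k φ) ∧ _) from fun h => hS h.2.2)]
    ring

/-- A good relabelling for `T_A` at `p`: A- and B-labels to `0, …, m-1`, both singleton labels
to `top`. [cite: IkenmeyerKandasamy2019, Thm. 4.3 (first bullet)] -/
def phiA (k : ℕ) (u : Fin (4 * k + 10)) : Fin (2 * k + 4) :=
  ⟨if (u : ℕ) < 2 * k + 4 then u else if (u : ℕ) < 4 * k + 8 then u - (2 * k + 4) else 2 * k + 3,
    by split_ifs <;> omega⟩

/-- A good relabelling for `T_C` at `A′ · p`: A-labels to `0, …, m-1`, the constant B-labels to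
`1, …, m-2`, `β₁, β₂ ↦ top`, `β₃, β₄ ↦ bottom`. [cite: IkenmeyerKandasamy2019, Thm. 4.3 (first bullet)] -/
def phiC (k : ℕ) (u : Fin (4 * k + 10)) : Fin (2 * k + 4) :=
  ⟨if (u : ℕ) < 2 * k + 4 then u else if (u : ℕ) < 4 * k + 6 then u - (2 * k + 3)
    else if (u : ℕ) < 4 * k + 8 then 2 * k + 3 else 0, by split_ifs <;> omega⟩

/-- Values of `extF phiA`. [folklore] -/
private theorem extF_phiA_val {u : ℕ} (hu : u < 4 * k + 10) :
    ((extF k (phiA k) u : Fin (2 * k + 4)) : ℕ) =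
      if u < 2 * k + 4 then u else if u < 4 * k + 8 then u - (2 * k + 4) else 2 * k + 3 := by
  rw [extF_of_lt k _ hu]; rfl

/-- Values of `extF phiC`. [folklore] -/
private theorem extF_phiC_val {u : ℕ} (hu : u < 4 * k + 10) :
    ((extF k (phiC k) u : Fin (2 * k + 4)) : ℕ) =
      if u < 2 * k + 4 then u else if u < 4 * k + 6 then u - (2 * k + 3)
      else if u < 4 * k + 8 then 2 * k + 3 else 0 := by
  rw [extF_of_lt k _ hu]; rfl

/-- `phiA` is a good relabelling for `T_A` at `p`. [folklore] -/
private theorem goodA_phiA : GoodA k (phiA k) := by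
  refine ⟨?_, ?_, ?_⟩
  · intro r r' h
    have h' := congrArg Fin.val h
    unfold wA at h'
    rw [extF_phiA_val k (by omega), extF_phiA_val k (by omega)] at h'
    apply Fin.ext; split_ifs at h' <;> omega
  · intro r r' h
    have h' := congrArg Fin.val h
    unfold wB at h'
    rw [extF_phiA_val k (by omega), extF_phiA_val k (by omega)] at h'
    apply Fin.ext; split_ifs at h' <;> omega
  · intro t ht
    apply Fin.ext
    rw [extF_phiA_val k (labA_lt k (c := 4 * k + 8 + t) (r := 0) (by omega)
      (by unfold hgt; split_ifs <;> omega))]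
    unfold labA topIdx
    simp only []
    split_ifs <;> omega

/-- The B-block values of `T_C` under `phiC`, in closed form. [folklore] -/
private theorem wC_phiC_val {j r : ℕ} (hj : j < 2 * k + 4) (hr : r < 2 * k + 4) :
    ((wC k (phiC k) j ⟨r, hr⟩ : Fin (2 * k + 4)) : ℕ) =
      if r < 2 * k + 2 then r + 1 else if r = 2 * k + 2 then 2 * k + 3 else 0 := by
  rw [wC_mk k _ hj hr, extF_phiC_val k (by split_ifs <;> omega)]
  split_ifs <;> omega

/-- `phiC` is a good relabelling for `T_C` at `A′ · p`. [folklore] -/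
private theorem goodC_phiC : GoodC k (phiC k) := by
  refine ⟨?_, ?_, ?_⟩
  · intro r r' h
    have h' := congrArg Fin.val h
    unfold wA at h'
    rw [extF_phiC_val k (by omega), extF_phiC_val k (by omega)] at h'
    apply Fin.ext; split_ifs at h' <;> omega
  · rintro j hj ⟨r, hr⟩ ⟨r', hr'⟩ h
    have h' := congrArg Fin.val h
    rw [wC_phiC_val k hj hr, wC_phiC_val k hj hr'] at h'
    apply Fin.ext
    show r = r'
    split_ifs at h' <;> omega
  · intro t ht
    rw [Fin.ext_iff, Fin.ext_iff, topIdx_val, botIdx_val, labC_S k ht,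
      extF_phiC_val k (by split_ifs <;> omega)]
    split_ifs <;> omega

/-- **`F_A(p) ≠ 0`.** [cite: IkenmeyerKandasamy2019, Thm. 4.3 (first bullet)] -/
theorem aeval_polyA_one_ne_zero :
    aeval (formCoeff (2 * k + 4)
        (linSubst (Fin (2 * k + 4)) ℂ 1 (psum (Fin (2 * k + 4)) ℂ (2 * k + 4)))) (polyA k) ≠ 0 := by
  rw [aeval_polyA]
  simp only [termA_one, Finset.sum_boole]
  refine mul_ne_zero (pow_ne_zero _ (by exact_mod_cast Nat.factorial_ne_zero _)) ?_
  rw [Nat.cast_ne_zero]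
  exact Finset.card_ne_zero_of_mem (Finset.mem_filter.mpr ⟨Finset.mem_univ _, goodA_phiA k⟩)

/-- **`F_C(p) = 0`.** [cite: IkenmeyerKandasamy2019, Thm. 4.3 (first bullet)] -/
theorem aeval_polyC_one_eq_zero :
    aeval (formCoeff (2 * k + 4)
        (linSubst (Fin (2 * k + 4)) ℂ 1 (psum (Fin (2 * k + 4)) ℂ (2 * k + 4)))) (polyC k) = 0 := by
  rw [aeval_polyC]
  simp only [termC_one, Finset.sum_const_zero, mul_zero]

/-- **`F_C(A′ · p) ≠ 0`.** [cite: IkenmeyerKandasamy2019, Thm. 4.3 (first bullet)] -/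
theorem aeval_polyC_matT_ne_zero :
    aeval (formCoeff (2 * k + 4)
        (linSubst (Fin (2 * k + 4)) ℂ (matT k) (psum (Fin (2 * k + 4)) ℂ (2 * k + 4)))) (polyC k) ≠ 0 := by
  rw [aeval_polyC]
  simp only [termC_matT, Finset.sum_boole]
  refine mul_ne_zero (pow_ne_zero _ (by exact_mod_cast Nat.factorial_ne_zero _)) ?_
  rw [Nat.cast_ne_zero]
  exact Finset.card_ne_zero_of_mem (Finset.mem_filter.mpr ⟨Finset.mem_univ _, goodC_phiC k⟩)

end Values

/-! ### §4 IK Thm. 4.3, first bullet: `mult_{ν^*} ℂ[\overline{GL_m · p}] ≥ 2` -/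

/-- The power sum is not zero (its value at `(1, …, 1)` is `m`). [folklore] -/
private theorem psum_ne_zero' : psum (Fin (2 * k + 4)) ℂ (2 * k + 4) ≠ 0 := by
  intro h
  have := congrArg (MvPolynomial.eval fun _ : Fin (2 * k + 4) => (1 : ℂ)) h
  rw [psum, map_sum, map_zero] at this
  simp only [map_pow, MvPolynomial.eval_X, one_pow, Finset.sum_const, Finset.card_univ,
    Fintype.card_fin, nsmul_eq_mul, mul_one] at this
  exact absurd this (by exact_mod_cast (show 2 * k + 4 ≠ 0 by omega))

/-- **IK Thm. 4.3, first bullet, by elementary certificates**: the classes of `F_A`, `F_C` in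
`ℂ[\overline{GL_m · p}]` are two linearly independent highest-weight vectors of weight `ν^*`
(their evaluation matrix at the closure points `p = 1 · p` and `A′ · p` is triangular with nonzero
diagonal), hence `2 ≤ mult_{ν^*} ℂ[\overline{GL_m · p}]`, `m = 2k + 4`.
[cite: IkenmeyerKandasamy2019, Thm. 4.3 (first bullet)] -/
theorem two_le_orbitMultiplicity_psum :
    2 ≤ orbitMultiplicity ℂ (psum (Fin (2 * k + 4)) ℂ (2 * k + 4)) (2 * k + 4)
      (Weight.dualOfPartition (2 * k + 4) (ikPartition (2 * k + 4))) := by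
  refine le_orbitMultiplicity_of_det_eval_ne_zero_of_mem_orbitClosure (by omega)
    (psum_isHomogeneous _ _ _) (psum_ne_zero' k) ![polyA k, polyC k] ?_
    ![linSubst (Fin (2 * k + 4)) ℂ 1 (psum (Fin (2 * k + 4)) ℂ (2 * k + 4)),
      linSubst (Fin (2 * k + 4)) ℂ (matT k) (psum (Fin (2 * k + 4)) ℂ (2 * k + 4))] ?_ ?_
  · intro i
    fin_cases i
    · exact polyA_mem_highestWeightSpace k
    · exact polyC_mem_highestWeightSpace k
  · intro j
    fin_cases j <;> exact linSubst_mem_orbitClosure _ _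
  · rw [Matrix.det_fin_two]
    simp only [Matrix.of_apply, Matrix.cons_val_zero, Matrix.cons_val_one,
      aeval_polyC_one_eq_zero, mul_zero, sub_zero]
    exact mul_ne_zero (aeval_polyA_one_ne_zero k) (aeval_polyC_matT_ne_zero k)


/-! ### §5 Rescaling variables, evaluation of substituted polynomials -/

section Rescale

variable {σ τ : Type*} {A : Type*} [CommSemiring A]

/-- Coefficients after rescaling the variables `X_v ↦ t_v X_v`. [folklore] -/
private theorem coeff_aeval_scale (t : σ → A) (φ : MvPolynomial σ A) (d : σ →₀ ℕ) :
    coeff d (aeval (fun v => C (t v) * X v) φ) = (d.prod fun v n => t v ^ n) * coeff d φ := by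
  classical
  induction φ using MvPolynomial.induction_on' with
  | monomial e c =>
    have hprod : (e.prod fun v n => (C (t v) * X v : MvPolynomial σ A) ^ n) =
        C (e.prod fun v n => t v ^ n) * e.prod fun v n => (X v : MvPolynomial σ A) ^ n := by
      rw [map_finsuppProd, ← Finsupp.prod_mul]
      exact Finsupp.prod_congr fun v _ => by rw [mul_pow, C_pow]
    rw [aeval_monomial, hprod, algebraMap_eq, ← mul_assoc, ← C_mul, ← monomial_eq, coeff_monomial,
      coeff_monomial]
    split_ifs with h
    · subst h; ring
    · rw [mul_zero]
  | add p q hp hq => rw [map_add, coeff_add, coeff_add, hp, hq, mul_add]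

/-- Evaluating a substituted polynomial: `(φ ∘ F)(x) = φ(F(x))`. [folklore] -/
private theorem eval_aeval_eq (x : τ → A) (F : σ → MvPolynomial τ A) (φ : MvPolynomial σ A) :
    eval x (aeval F φ) = eval (fun i => eval x (F i)) φ := by
  rw [aeval_eq_bind₁]
  exact eval₂Hom_bind₁ _ _ _ _

end Rescale

/-! ### §6 Row and column degrees as a weight -/

section Weights

variable (N : ℕ)

/-- The bi-degree weight: the variable `z_{ij}` has weight `(e_i, e_j)` (row content, column
content). [folklore] -/
def wRC : Fin N × Fin N → (Fin N → ℕ) × (Fin N → ℕ) :=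
  fun v => (fun i => if v.1 = i then 1 else 0, fun j => if v.2 = j then 1 else 0)

variable {N}

/-- Row degrees of a monomial. [folklore] -/
private theorem weight_wRC_fst (e : Fin N × Fin N →₀ ℕ) (i : Fin N) :
    (Finsupp.weight (wRC N) e).1 i = ∑ v ∈ e.support, if v.1 = i then e v else 0 := by
  rw [Finsupp.weight_apply, Finsupp.sum, Prod.fst_sum, Finset.sum_apply]
  refine Finset.sum_congr rfl fun v _ => ?_
  simp [wRC]

/-- Column degrees of a monomial. [folklore] -/
private theorem weight_wRC_snd (e : Fin N × Fin N →₀ ℕ) (j : Fin N) :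
    (Finsupp.weight (wRC N) e).2 j = ∑ v ∈ e.support, if v.2 = j then e v else 0 := by
  rw [Finsupp.weight_apply, Finsupp.sum, Prod.snd_sum, Finset.sum_apply]
  refine Finset.sum_congr rfl fun v _ => ?_
  simp [wRC]

/-- The total degree is the sum of the row degrees. [folklore] -/
private theorem sum_weight_wRC_fst (e : Fin N × Fin N →₀ ℕ) :
    ∑ i, (Finsupp.weight (wRC N) e).1 i = ∑ v ∈ e.support, e v := by
  simp_rw [weight_wRC_fst]
  rw [Finset.sum_comm]
  exact Finset.sum_congr rfl fun v _ => by rw [Finset.sum_ite_eq, if_pos (Finset.mem_univ _)]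

/-- The total degree is the sum of the column degrees. [folklore] -/
private theorem sum_weight_wRC_snd (e : Fin N × Fin N →₀ ℕ) :
    ∑ j, (Finsupp.weight (wRC N) e).2 j = ∑ v ∈ e.support, e v := by
  simp_rw [weight_wRC_snd]
  rw [Finset.sum_comm]
  exact Finset.sum_congr rfl fun v _ => by rw [Finset.sum_ite_eq, if_pos (Finset.mem_univ _)]

variable {A : Type*} [CommSemiring A]

/-- The rescaling factor of a monomial under `z_{i₀ j} ↦ a z_{i₀ j}` is `a^{row degree}`.
[folklore] -/
private theorem prod_pow_ite_fst (e : Fin N × Fin N →₀ ℕ) (i₀ : Fin N) (a : A) :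
    (e.prod fun v n => (if v.1 = i₀ then a else 1) ^ n) = a ^ (Finsupp.weight (wRC N) e).1 i₀ := by
  rw [weight_wRC_fst, Finsupp.prod, ← Finset.prod_pow_eq_pow_sum]
  refine Finset.prod_congr rfl fun v _ => ?_
  split_ifs <;> simp

/-- The rescaling factor of a monomial under `z_{i j₀} ↦ a z_{i j₀}` is `a^{column degree}`.
[folklore] -/
private theorem prod_pow_ite_snd (e : Fin N × Fin N →₀ ℕ) (j₀ : Fin N) (a : A) :
    (e.prod fun v n => (if v.2 = j₀ then a else 1) ^ n) = a ^ (Finsupp.weight (wRC N) e).2 j₀ := by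
  rw [weight_wRC_snd, Finsupp.prod, ← Finset.prod_pow_eq_pow_sum]
  refine Finset.prod_congr rfl fun v _ => ?_
  split_ifs <;> simp

/-- **Row scaling identity**: if every monomial of `φ` has degree `r` in the row `i₀`, then
substituting `W · f` for the row-`i₀` variables multiplies the value by `W^r`. [folklore] -/
private theorem aeval_rowScale {B : Type*} [CommSemiring B] [Algebra A B] (φ : MvPolynomial (Fin N × Fin N) A)
    (i₀ : Fin N) (r : ℕ) (hφ : ∀ e ∈ φ.support, (Finsupp.weight (wRC N) e).1 i₀ = r)
    (f : Fin N × Fin N → B) (W : B) :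
    aeval (fun v => if v.1 = i₀ then W * f v else f v) φ = W ^ r * aeval f φ := by
  rw [φ.as_sum, map_sum, map_sum, Finset.mul_sum]
  refine Finset.sum_congr rfl fun e he => ?_
  rw [aeval_monomial, aeval_monomial, ← hφ e he, ← prod_pow_ite_fst e i₀ W]
  have : (e.prod fun v n => (if v.1 = i₀ then W * f v else f v) ^ n) =
      (e.prod fun v n => (if v.1 = i₀ then W else 1) ^ n) * e.prod fun v n => f v ^ n := by
    rw [← Finsupp.prod_mul]
    exact Finsupp.prod_congr fun v _ => by split_ifs <;> simp [mul_pow]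
  rw [this]; ring

end Weights

/-! ### §7 Quotients of weighted homogeneous polynomials -/

section Quotient

variable {σ M A : Type*} [AddCancelCommMonoid M] [DecidableEq M] [CommRing A] [NoZeroDivisors A]

/-- **A quotient of weighted homogeneous polynomials is weighted homogeneous** (integral
coefficients): if `p ≠ 0` is homogeneous of weight `a`, `p q` is homogeneous of weight `c` and
`a + n = c`, then `q` is homogeneous of weight `n`. [folklore] -/
private theorem isWeightedHomogeneous_of_mul {w : σ → M} {p q : MvPolynomial σ A} {a c n : M}
    (hp : IsWeightedHomogeneous w p a) (hp0 : p ≠ 0) (hpq : IsWeightedHomogeneous w (p * q) c)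
    (hn : a + n = c) : IsWeightedHomogeneous w q n := by
  classical
  intro d hd
  by_contra hne
  set qn := weightedHomogeneousComponent w (Finsupp.weight w d) q with hqn
  have hqn0 : qn ≠ 0 := by
    intro h
    apply hd
    have := congrArg (coeff d) h
    rwa [hqn, coeff_weightedHomogeneousComponent, if_pos rfl, coeff_zero] at this
  have h1 : weightedHomogeneousComponent w (a + Finsupp.weight w d) (p * q) = 0 :=
    hpq.weightedHomogeneousComponent_ne _ fun h => hne (add_left_cancel (h.trans hn.symm))
  have h2 : weightedHomogeneousComponent w (a + Finsupp.weight w d) (p * q) = p * qn := by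
    have hsplit : p * q = p * qn + p * (q - qn) := by ring
    rw [hsplit, map_add,
      (hp.mul (weightedHomogeneousComponent_isWeightedHomogeneous _ _)).weightedHomogeneousComponent_same,
      add_eq_left]
    ext d'
    rw [coeff_weightedHomogeneousComponent, coeff_zero]
    split_ifs with hd'
    · rw [coeff_mul]
      refine Finset.sum_eq_zero fun xy hxy => ?_
      by_cases hx : coeff xy.1 p = 0
      · rw [hx, zero_mul]
      by_cases hy : coeff xy.2 (q - qn) = 0
      · rw [hy, mul_zero]
      exfalso
      have hwy : Finsupp.weight w xy.2 ≠ Finsupp.weight w d := by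
        intro h; apply hy
        rw [coeff_sub, hqn, coeff_weightedHomogeneousComponent, if_pos h, sub_self]
      have hwx : Finsupp.weight w xy.1 = a := hp hx
      have hsum := Finset.mem_antidiagonal.mp hxy
      rw [← hsum, map_add, hwx] at hd'
      exact hwy (add_left_cancel hd')
    · rfl
  rw [h2] at h1
  exact hqn0 ((mul_eq_zero.mp h1).resolve_left hp0)

end Quotient

/-! ### §8 The generic matrix and the structure of the semi-invariants -/

section Structure

open Literature.NumberTheory.DiophantineGeometry

variable (n : ℕ)

/-- The polynomial ring of the matrix space `Mat_N`, `N = n + 2`. [folklore] -/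
abbrev Rm : Type := MvPolynomial (Fin (n + 2) × Fin (n + 2)) ℂ

/-- The generic matrix `Z = (z_{ij})`. [folklore] -/
abbrev ZZ : Matrix (Fin (n + 2)) (Fin (n + 2)) (Rm n) :=
  Matrix.mvPolynomialX (Fin (n + 2)) (Fin (n + 2)) ℂ

/-- The minor `d = det Z[1…, 1…]` (row and column `0` deleted). [folklore] -/
def dMinor : Rm n := ((ZZ n).submatrix Fin.succ Fin.succ).det

/-- The entries of `M₀ = [e_0; z_1; …; z_{N-1}]`: the generic matrix with row `0` replaced by
`e_0`. [folklore] -/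
def M0 (v : Fin (n + 2) × Fin (n + 2)) : Rm n :=
  if v.1 = 0 then (if v.2 = 0 then 1 else 0) else X v

/-- The row degrees `ρ = (2N, …, 2N, 4N)` of a semi-invariant of weight `ν^*`,
`ν = (4N, 2N, …, 2N)`. [cite: IkenmeyerKandasamy2019, Thm. 4.3 (second bullet)] -/
def rho (i : Fin (n + 2)) : ℕ := if i = Fin.last (n + 1) then 4 * (n + 2) else 2 * (n + 2)

/-- The exponent vector of `∏_j z_{N-1, j}^2`. [folklore] -/
def e0 : Fin (n + 2) × Fin (n + 2) →₀ ℕ :=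
  Finsupp.equivFunOnFinite.symm fun v => if v.1 = Fin.last (n + 1) then 2 else 0

/-- **The unique semi-invariant** `P₀ = det(Z)^{2N} · ∏_j z_{N-1,j}^2` (up to scalars) of row
degrees `(2N, …, 2N, 4N)`, constant column degrees, invariant under adding later rows to earlier
ones. [cite: IkenmeyerKandasamy2019, Thm. 4.3 (second bullet)] -/
def P0 : Rm n := (ZZ n).det ^ (2 * (n + 2)) * monomial (e0 n) 1

/-- The test torus element `diag(…, 2, …, 2⁻¹, …)` (`2` at `a`, `2⁻¹` at `b`). [folklore] -/
def tAB (a b : Fin (n + 2)) (j : Fin (n + 2)) : ℂ := if j = a then 2 else if j = b then 2⁻¹ else 1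

/-- The test torus element has nonzero entries. [folklore] -/
private theorem tAB_ne_zero (a b j : Fin (n + 2)) : tAB n a b j ≠ 0 := by
  unfold tAB; split_ifs <;> norm_num

/-- The test torus element has determinant `1`. [folklore] -/
private theorem prod_tAB {a b : Fin (n + 2)} (hab : a ≠ b) : ∏ j, tAB n a b j = 1 := by
  rw [prod_eq_mul_of_ne hab (tAB n a b) fun l hla hlb => by unfold tAB; rw [if_neg hla, if_neg hlb]]
  unfold tAB
  rw [if_pos rfl, if_neg (Ne.symm hab), if_pos rfl]
  norm_num

/-- `0 ≠ N - 1` in `Fin N`, `N ≥ 2`. [folklore] -/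
private theorem zero_ne_last : (0 : Fin (n + 2)) ≠ Fin.last (n + 1) := by
  intro h
  have := congrArg Fin.val h
  rw [Fin.val_zero, Fin.val_last] at this
  omega

variable {n}

/-- The hypotheses on a polynomial `P` on `Mat_N` coming from a highest-weight vector of weight
`χ = ν^*` in `ℂ[\overline{GL_N · x_1⋯x_N}]`: left semi-invariance under the upper triangular Borel,
right invariance under the test torus elements of the stabilizer, and the values of `χ`.
[cite: IkenmeyerKandasamy2019, Thm. 4.3 (second bullet)] -/
structure IsIKPoly (χ : Weight (Fin (n + 2))) (P : Rm n) : Prop where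
  left : ∀ b : GL (Fin (n + 2)) ℂ, IsUpperTriangular b → ∀ g : GL (Fin (n + 2)) ℂ,
    eval (fun ij : Fin (n + 2) × Fin (n + 2) =>
        ((b : Matrix (Fin (n + 2)) (Fin (n + 2)) ℂ) * (g : Matrix (Fin (n + 2)) (Fin (n + 2)) ℂ)) ij.1 ij.2) P =
      (weightChar χ b)⁻¹ *
        eval (fun ij : Fin (n + 2) × Fin (n + 2) => (g : Matrix (Fin (n + 2)) (Fin (n + 2)) ℂ) ij.1 ij.2) P
  right : ∀ a b : Fin (n + 2), a ≠ b → ∀ g : GL (Fin (n + 2)) ℂ,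
    eval (fun ij : Fin (n + 2) × Fin (n + 2) =>
        ((g : Matrix (Fin (n + 2)) (Fin (n + 2)) ℂ) *
          ((torusElt (tAB n a b) (tAB_ne_zero n a b) : GL (Fin (n + 2)) ℂ) :
            Matrix (Fin (n + 2)) (Fin (n + 2)) ℂ)) ij.1 ij.2) P =
      eval (fun ij : Fin (n + 2) × Fin (n + 2) => (g : Matrix (Fin (n + 2)) (Fin (n + 2)) ℂ) ij.1 ij.2) P
  chi : ∀ i, χ i = -(rho n i : ℤ)

variable {χ : Weight (Fin (n + 2))} {P : Rm n}

/-- **Row degrees** of a semi-invariant of weight `ν^*`: `2N` in the rows `< N - 1`, `4N` in the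
last row (diagonal part of the Borel, `GL` dense in `Mat`). [folklore] -/
private theorem rowDeg_eq (hP : IsIKPoly χ P) {e : Fin (n + 2) × Fin (n + 2) →₀ ℕ} (he : e ∈ P.support)
    (i₀ : Fin (n + 2)) : (Finsupp.weight (wRC (n + 2)) e).1 i₀ = rho n i₀ := by
  have hs0 : ∀ i : Fin (n + 2), (fun i => if i = i₀ then (2 : ℂ) else 1) i ≠ 0 := fun i => by
    dsimp only; split_ifs <;> norm_num
  have hid : aeval (fun v : Fin (n + 2) × Fin (n + 2) =>
      C ((fun i => if i = i₀ then (2 : ℂ) else 1) v.1) * X v) P = C ((2 : ℂ) ^ rho n i₀) * P := by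
    apply MvPolynomial.eq_of_eval_eq_on_gl
    intro g
    rw [eval_aeval_eq, map_mul, eval_C]
    have h := hP.left (torusElt _ hs0) (isDiagonalGL_torusElt _ hs0).isUpperTriangular g
    rw [weightChar_torusElt, coe_torusElt] at h
    have hw : (∏ i, (fun i => if i = i₀ then (2 : ℂ) else 1) i ^ χ i)⁻¹ = (2 : ℂ) ^ rho n i₀ := by
      rw [Finset.prod_eq_single i₀ (fun i _ hi => by simp [hi]) (fun h => absurd (Finset.mem_univ _) h)]
      dsimp only
      rw [if_pos rfl, hP.chi i₀, zpow_neg, inv_inv, zpow_natCast]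
    rw [hw] at h
    convert h using 2
    congr 1
    funext v
    rw [map_mul, eval_C, eval_X, Matrix.diagonal_mul]
  have hc := congrArg (coeff e) hid
  rw [coeff_aeval_scale, coeff_C_mul] at hc
  have hprod : (e.prod fun v k => (fun i => if i = i₀ then (2 : ℂ) else 1) v.1 ^ k) =
      (2 : ℂ) ^ (Finsupp.weight (wRC (n + 2)) e).1 i₀ := prod_pow_ite_fst e i₀ 2
  rw [hprod] at hc
  have h2 := mul_right_cancel₀ (mem_support_iff.mp he) hc
  exact Nat.pow_right_injective (le_refl 2) (by exact_mod_cast h2)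

/-- **Column degrees agree** (the stabilizing torus `diag(…, 2, …, 2⁻¹, …)` of `x_1⋯x_N`).
[folklore] -/
private theorem colDeg_eq_colDeg (hP : IsIKPoly χ P) {e : Fin (n + 2) × Fin (n + 2) →₀ ℕ}
    (he : e ∈ P.support) {a b : Fin (n + 2)} (hab : a ≠ b) :
    (Finsupp.weight (wRC (n + 2)) e).2 a = (Finsupp.weight (wRC (n + 2)) e).2 b := by
  have hid : aeval (fun v : Fin (n + 2) × Fin (n + 2) => C (tAB n a b v.2) * X v) P = P := by
    apply MvPolynomial.eq_of_eval_eq_on_gl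
    intro g
    rw [eval_aeval_eq]
    have h := hP.right a b hab g
    rw [coe_torusElt] at h
    convert h using 2
    congr 1
    funext v
    rw [map_mul, eval_C, eval_X, Matrix.mul_diagonal, mul_comm]
  have hc := congrArg (coeff e) hid
  rw [coeff_aeval_scale] at hc
  have h1 : (e.prod fun v k => tAB n a b v.2 ^ k) = 1 :=
    mul_right_cancel₀ (mem_support_iff.mp he) (hc.trans (one_mul _).symm)
  have h2 : (e.prod fun v k => tAB n a b v.2 ^ k) =
      (2 : ℂ) ^ (Finsupp.weight (wRC (n + 2)) e).2 a *
        (2⁻¹ : ℂ) ^ (Finsupp.weight (wRC (n + 2)) e).2 b := by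
    rw [← prod_pow_ite_snd, ← prod_pow_ite_snd, ← Finsupp.prod_mul]
    refine Finsupp.prod_congr fun v _ => ?_
    rw [← mul_pow]
    congr 1
    unfold tAB
    by_cases ha : v.2 = a
    · rw [if_pos ha, if_pos ha, if_neg (fun h => hab (ha.symm.trans h)), mul_one]
    · rw [if_neg ha, if_neg ha, one_mul]
  rw [h2, inv_pow] at h1
  have h2ne : (2 : ℂ) ^ (Finsupp.weight (wRC (n + 2)) e).2 b ≠ 0 := pow_ne_zero _ two_ne_zero
  have h3 : (2 : ℂ) ^ (Finsupp.weight (wRC (n + 2)) e).2 a = (2 : ℂ) ^ (Finsupp.weight (wRC (n + 2)) e).2 b := by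
    calc (2 : ℂ) ^ (Finsupp.weight (wRC (n + 2)) e).2 a
        = (2 : ℂ) ^ (Finsupp.weight (wRC (n + 2)) e).2 a * ((2 : ℂ) ^ (Finsupp.weight (wRC (n + 2)) e).2 b)⁻¹ *
            (2 : ℂ) ^ (Finsupp.weight (wRC (n + 2)) e).2 b := by rw [inv_mul_cancel_right₀ h2ne]
      _ = (2 : ℂ) ^ (Finsupp.weight (wRC (n + 2)) e).2 b := by rw [h1, one_mul]
  exact Nat.pow_right_injective (le_refl 2) (by exact_mod_cast h3)

/-- The sum of the row degrees. [folklore] -/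
private theorem sum_rho : ∑ i, rho n i = (n + 2) * (2 * n + 6) := by
  rw [Fin.sum_univ_castSucc]
  have h1 : ∀ i : Fin (n + 1), rho n (Fin.castSucc i) = 2 * (n + 2) := fun i => by
    unfold rho; rw [if_neg (Fin.castSucc_lt_last i).ne]
  have h2 : rho n (Fin.last (n + 1)) = 4 * (n + 2) := by unfold rho; rw [if_pos rfl]
  simp only [h1, h2, Finset.sum_const, Finset.card_univ, Fintype.card_fin, smul_eq_mul]
  ring

/-- **Column degrees** `= 2N + 2`. [folklore] -/
private theorem colDeg_eq (hP : IsIKPoly χ P) {e : Fin (n + 2) × Fin (n + 2) →₀ ℕ} (he : e ∈ P.support)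
    (j : Fin (n + 2)) : (Finsupp.weight (wRC (n + 2)) e).2 j = 2 * n + 6 := by
  have hrow : ∑ i, (Finsupp.weight (wRC (n + 2)) e).1 i = (n + 2) * (2 * n + 6) := by
    rw [Finset.sum_congr rfl fun i _ => rowDeg_eq hP he i, sum_rho]
  have hcol : ∑ j', (Finsupp.weight (wRC (n + 2)) e).2 j' = (n + 2) * (Finsupp.weight (wRC (n + 2)) e).2 j := by
    rw [Finset.sum_congr rfl fun j' _ => show (Finsupp.weight (wRC (n + 2)) e).2 j' =
        (Finsupp.weight (wRC (n + 2)) e).2 j from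
      if h : j' = j then by rw [h] else colDeg_eq_colDeg hP he h]
    simp
  have key : (n + 2) * (Finsupp.weight (wRC (n + 2)) e).2 j = (n + 2) * (2 * n + 6) := by
    rw [← hcol, sum_weight_wRC_snd, ← sum_weight_wRC_fst, hrow]
  exact Nat.eq_of_mul_eq_mul_left (by omega) key

/-- The semi-invariant is bihomogeneous of bidegree `(ρ, (2N+2)^N)`. [folklore] -/
private theorem isWeightedHomogeneous_P (hP : IsIKPoly χ P) :
    IsWeightedHomogeneous (wRC (n + 2)) P (rho n, fun _ => 2 * n + 6) := by
  intro e he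
  have he' : e ∈ P.support := mem_support_iff.mpr he
  exact Prod.ext (funext fun i => rowDeg_eq hP he' i) (funext fun j => colDeg_eq hP he' j)

/-- The determinant is bihomogeneous of bidegree `((1^N), (1^N))`. [folklore] -/
private theorem isWeightedHomogeneous_det :
    IsWeightedHomogeneous (wRC (n + 2)) (ZZ n).det ((fun _ => 1, fun _ => 1)) := by
  rw [Matrix.det_apply]
  refine IsWeightedHomogeneous.sum _ _ _ fun σ _ => ?_
  have hprod : IsWeightedHomogeneous (wRC (n + 2)) (∏ i, (ZZ n) (σ i) i)
      (∑ i, wRC (n + 2) (σ i, i)) :=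
    IsWeightedHomogeneous.prod _ _ _ fun i _ => by
      show IsWeightedHomogeneous _ (X (σ i, i)) _
      exact isWeightedHomogeneous_X _ _ _
  have hsum : ∑ i, wRC (n + 2) (σ i, i) = ((fun _ => 1, fun _ => 1) : (Fin (n + 2) → ℕ) × (Fin (n + 2) → ℕ)) := by
    refine Prod.ext (funext fun i' => ?_) (funext fun j' => ?_)
    · rw [Prod.fst_sum, Finset.sum_apply]
      simp only [wRC]
      rw [Equiv.sum_comp σ (fun i => if i = i' then 1 else 0)]
      simp
    · rw [Prod.snd_sum, Finset.sum_apply]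
      simp [wRC]
  rw [hsum] at hprod
  rw [Units.smul_def]
  exact zsmul_mem (show _ ∈ weightedHomogeneousSubmodule ℂ (wRC (n + 2)) _ from hprod) _

/-- Values of `d` at a matrix. [folklore] -/
private theorem eval_dMinor (G : Matrix (Fin (n + 2)) (Fin (n + 2)) ℂ) :
    eval (fun ij : Fin (n + 2) × Fin (n + 2) => G ij.1 ij.2) (dMinor n) =
      (G.submatrix Fin.succ Fin.succ).det := by
  rw [dMinor, RingHom.map_det]
  congr 1
  ext i j
  simp

/-- `d ≠ 0` (its value at the identity matrix is `1`). [folklore] -/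
private theorem dMinor_ne_zero : dMinor n ≠ 0 := by
  intro h
  have h1 := eval_dMinor (n := n) (1 : Matrix (Fin (n + 2)) (Fin (n + 2)) ℂ)
  have hsub : (1 : Matrix (Fin (n + 2)) (Fin (n + 2)) ℂ).submatrix Fin.succ Fin.succ = 1 := by
    ext i j
    simp [Matrix.one_apply, Fin.succ_inj]
  rw [h, map_zero, hsub, Matrix.det_one] at h1
  exact zero_ne_one h1

/-- `det Z ∤ d` (at `diag(0, 1, …, 1)` the determinant vanishes but `d = 1`). [folklore] -/
private theorem det_not_dvd_dMinor : ¬ (ZZ n).det ∣ dMinor n := by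
  rintro ⟨q, hq⟩
  set G : Matrix (Fin (n + 2)) (Fin (n + 2)) ℂ := Matrix.diagonal fun i => if i = 0 then 0 else 1 with hG
  have h1 := eval_dMinor (n := n) G
  have hsub : G.submatrix Fin.succ Fin.succ = 1 := by
    ext i j
    rw [Matrix.submatrix_apply, hG, Matrix.diagonal_apply, Matrix.one_apply]
    simp only [Fin.succ_inj, if_neg (Fin.succ_ne_zero i)]
  have hdet : eval (fun ij : Fin (n + 2) × Fin (n + 2) => G ij.1 ij.2) (ZZ n).det = 0 := by
    rw [Matrix.eval_det_mvPolynomialX]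
    have : (Matrix.of fun i j => G i j) = G := rfl
    rw [this, hG, Matrix.det_diagonal]
    exact Finset.prod_eq_zero (Finset.mem_univ (0 : Fin (n + 2))) (by simp)
  rw [hsub, Matrix.det_one, hq, map_mul, hdet, zero_mul] at h1
  exact one_ne_zero h1.symm

/-- `M₁ = M₀` with the row `0` scaled by `det Z`; the scaling identity. [folklore] -/
private theorem aeval_M1_eq (hP : IsIKPoly χ P) :
    aeval (fun v : Fin (n + 2) × Fin (n + 2) => if v.1 = 0 then (ZZ n).det * M0 n v else M0 n v) P =
      (ZZ n).det ^ (2 * (n + 2)) * aeval (M0 n) P :=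
  aeval_rowScale P 0 (2 * (n + 2))
    (fun e he => by rw [rowDeg_eq hP he 0]; unfold rho; rw [if_neg (zero_ne_last n)]) (M0 n) (ZZ n).det

/-- **The elimination step, pointwise**: at an invertible `g` with `d(g) ≠ 0`,
`P([det g · e_0; g_1; …; g_{N-1}]) = d(g)^{2N} P(g)`: the matrix `[det g · e_0; g_1; …] g⁻¹` is
upper triangular with diagonal `(d(g), 1, …, 1)`. [cite: IkenmeyerKandasamy2019, Thm. 4.3 (second bullet)] -/
theorem eval_M1 (hP : IsIKPoly χ P) (g : GL (Fin (n + 2)) ℂ)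
    (hδ : (((g : Matrix (Fin (n + 2)) (Fin (n + 2)) ℂ)).submatrix Fin.succ Fin.succ).det ≠ 0) :
    eval (fun ij : Fin (n + 2) × Fin (n + 2) => (g : Matrix (Fin (n + 2)) (Fin (n + 2)) ℂ) ij.1 ij.2)
        (aeval (fun v : Fin (n + 2) × Fin (n + 2) =>
          if v.1 = 0 then (ZZ n).det * M0 n v else M0 n v) P) =
      (((g : Matrix (Fin (n + 2)) (Fin (n + 2)) ℂ)).submatrix Fin.succ Fin.succ).det ^ (2 * (n + 2)) *
        eval (fun ij : Fin (n + 2) × Fin (n + 2) => (g : Matrix (Fin (n + 2)) (Fin (n + 2)) ℂ) ij.1 ij.2) P := by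
  set G : Matrix (Fin (n + 2)) (Fin (n + 2)) ℂ := (g : Matrix (Fin (n + 2)) (Fin (n + 2)) ℂ) with hG
  set δ : ℂ := (G.submatrix Fin.succ Fin.succ).det with hδdef
  set Mg : Matrix (Fin (n + 2)) (Fin (n + 2)) ℂ :=
    Matrix.of fun i j => if i = 0 then (if j = 0 then G.det else 0) else G i j with hMg
  have hevalM : (fun v : Fin (n + 2) × Fin (n + 2) => eval (fun ij : Fin (n + 2) × Fin (n + 2) => G ij.1 ij.2)
      (if v.1 = 0 then (ZZ n).det * M0 n v else M0 n v)) = fun v => Mg v.1 v.2 := by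
    funext v
    rw [hMg, Matrix.of_apply]
    unfold M0
    have hdet : eval (fun ij : Fin (n + 2) × Fin (n + 2) => G ij.1 ij.2) (ZZ n).det = G.det := by
      rw [Matrix.eval_det_mvPolynomialX]; rfl
    split_ifs <;> simp [hdet]
  rw [eval_aeval_eq, hevalM]
  have hunit : IsUnit G.det := (Matrix.isUnit_iff_isUnit_det _).mp (Units.isUnit g)
  have hGinv : G * G⁻¹ = 1 := Matrix.mul_nonsing_inv G hunit
  have hrow : ∀ i, i ≠ 0 → ∀ j, (Mg * G⁻¹) i j = (1 : Matrix (Fin (n + 2)) (Fin (n + 2)) ℂ) i j := by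
    intro i hi j
    rw [← hGinv, Matrix.mul_apply, Matrix.mul_apply]
    refine Finset.sum_congr rfl fun l _ => ?_
    rw [hMg, Matrix.of_apply, if_neg hi]
  have h00 : (Mg * G⁻¹) 0 0 = δ := by
    rw [Matrix.mul_apply]
    have hterm : ∀ l, Mg 0 l * G⁻¹ l 0 = if l = 0 then G.det * G⁻¹ 0 0 else 0 := by
      intro l
      rw [hMg, Matrix.of_apply, if_pos rfl]
      split_ifs with hl
      · rw [hl]
      · rw [zero_mul]
    rw [Finset.sum_congr rfl fun l _ => hterm l, Finset.sum_ite_eq' Finset.univ, if_pos (Finset.mem_univ _),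
      Matrix.inv_def, Matrix.smul_apply, Ring.inverse_eq_inv, smul_eq_mul, ← mul_assoc,
      mul_inv_cancel₀ hunit.ne_zero, one_mul, Matrix.adjugate_fin_succ_eq_det_submatrix,
      Fin.succAbove_zero]
    simp [hδdef]
  have htri : (Mg * G⁻¹).BlockTriangular id := by
    intro i j hij
    have hi : i ≠ 0 := by
      rintro rfl
      exact absurd hij (not_lt.mpr (Fin.zero_le _))
    have hij' : j < i := hij
    rw [hrow i hi j, Matrix.one_apply, if_neg (ne_of_lt hij').symm]
  have hdiag : ∀ i, i ≠ 0 → (Mg * G⁻¹) i i = 1 := fun i hi => by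
    rw [hrow i hi i, Matrix.one_apply_eq]
  have hdetb : (Mg * G⁻¹).det = δ := by
    rw [Matrix.det_of_upperTriangular htri, Fin.prod_univ_succ, h00,
      Finset.prod_eq_one fun i _ => hdiag _ (Fin.succ_ne_zero i), mul_one]
  set b : GL (Fin (n + 2)) ℂ := Matrix.GeneralLinearGroup.mkOfDetNeZero (Mg * G⁻¹) (by rw [hdetb]; exact hδ)
    with hb
  have hbval : (b : Matrix (Fin (n + 2)) (Fin (n + 2)) ℂ) = Mg * G⁻¹ :=
    Matrix.GeneralLinearGroup.val_mkOfDetNeZero _ _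
  have hbtri : IsUpperTriangular b := by
    show (b : Matrix (Fin (n + 2)) (Fin (n + 2)) ℂ).BlockTriangular id
    rw [hbval]; exact htri
  have hbg : (b : Matrix (Fin (n + 2)) (Fin (n + 2)) ℂ) * G = Mg := by
    rw [hbval, Matrix.nonsing_inv_mul_cancel_right G Mg hunit]
  have hwc : weightChar χ b = δ ^ (χ 0) := by
    unfold weightChar
    rw [Fin.prod_univ_succ, hbval, h00,
      Finset.prod_eq_one fun i _ => by rw [hdiag _ (Fin.succ_ne_zero i), one_zpow], mul_one]
  have h := hP.left b hbtri g
  simp only [← hG] at h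
  simp only [hbg, hwc, hP.chi 0] at h
  rw [h]
  congr 1
  unfold rho
  rw [if_neg (zero_ne_last n), zpow_neg, inv_inv, zpow_natCast]

/-- **`det(Z)^{2N}` divides `d^{2N} P`**: `d^{2N} P = det^{2N} · P(M₀)` as polynomials (both sides
times `d` agree on `GL_N`, which is Zariski dense; `d ≠ 0`). [cite: IkenmeyerKandasamy2019, Thm. 4.3 (second bullet)] -/
theorem det_pow_dvd (hP : IsIKPoly χ P) :
    (ZZ n).det ^ (2 * (n + 2)) ∣ dMinor n ^ (2 * (n + 2)) * P := by
  have key : dMinor n * (aeval (fun v : Fin (n + 2) × Fin (n + 2) =>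
      if v.1 = 0 then (ZZ n).det * M0 n v else M0 n v) P - dMinor n ^ (2 * (n + 2)) * P) = 0 := by
    apply MvPolynomial.eq_of_eval_eq_on_gl
    intro g
    rw [map_zero, map_mul]
    by_cases hδ : (((g : Matrix (Fin (n + 2)) (Fin (n + 2)) ℂ)).submatrix Fin.succ Fin.succ).det = 0
    · rw [eval_dMinor, hδ, zero_mul]
    · rw [map_sub, map_mul, map_pow, eval_M1 hP g hδ, eval_dMinor, sub_self, mul_zero]
  rw [mul_sub, sub_eq_zero] at key
  have h2 := mul_left_cancel₀ (dMinor_ne_zero (n := n)) key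
  rw [aeval_M1_eq hP] at h2
  exact ⟨aeval (M0 n) P, h2.symm⟩

/-- The only exponent vector of bidegree `((0, …, 0, 2N), (2, …, 2))` is that of
`∏_j z_{N-1,j}^2`. [folklore] -/
private theorem eq_e0 {e : Fin (n + 2) × Fin (n + 2) →₀ ℕ}
    (hw : Finsupp.weight (wRC (n + 2)) e =
      ((fun i => if i = Fin.last (n + 1) then 2 * (n + 2) else 0), fun _ => 2)) : e = e0 n := by
  have hfst : ∀ i, (Finsupp.weight (wRC (n + 2)) e).1 i = if i = Fin.last (n + 1) then 2 * (n + 2) else 0 :=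
    fun i => by rw [hw]
  have hsnd : ∀ j, (Finsupp.weight (wRC (n + 2)) e).2 j = 2 := fun j => by rw [hw]
  have hA : ∀ v : Fin (n + 2) × Fin (n + 2), v.1 ≠ Fin.last (n + 1) → e v = 0 := by
    intro v hv
    by_cases hvs : v ∈ e.support
    · have h := hfst v.1
      rw [if_neg hv, weight_wRC_fst] at h
      have := Finset.sum_eq_zero_iff.mp h v hvs
      rwa [if_pos rfl] at this
    · exact Finsupp.notMem_support_iff.mp hvs
  have hB : ∀ j, e (Fin.last (n + 1), j) = 2 := by
    intro j
    have h := hsnd j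
    rw [weight_wRC_snd, Finset.sum_eq_single (Fin.last (n + 1), j)] at h
    · simpa using h
    · intro v hv hne
      by_cases hv2 : v.2 = j
      · rw [if_pos hv2]
        apply hA
        intro hv1
        exact hne (Prod.ext hv1 hv2)
      · rw [if_neg hv2]
    · intro hn
      rw [if_pos rfl]
      exact Finsupp.notMem_support_iff.mp hn
  ext ⟨i, j⟩
  rw [e0, Finsupp.coe_equivFunOnFinite_symm]
  dsimp only
  by_cases hi : i = Fin.last (n + 1)
  · rw [if_pos hi, hi, hB]
  · rw [if_neg hi, hA _ hi]

/-- **Structure theorem**: every `P` satisfying the hypotheses is a scalar multiple of `P₀`.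
[cite: IkenmeyerKandasamy2019, Thm. 4.3 (second bullet)] -/
theorem mem_span_P0 (hP : IsIKPoly χ P) : P ∈ Submodule.span ℂ {P0 n} := by
  classical
  have hprime : Prime (ZZ n).det :=
    prime_det_of_X (k := ℂ) (ι := fun ij : Fin (n + 2) × Fin (n + 2) => ij) fun _ _ h => h
  obtain ⟨P₁, hP₁⟩ : (ZZ n).det ^ (2 * (n + 2)) ∣ P :=
    hprime.pow_dvd_of_dvd_mul_left _ (fun h => det_not_dvd_dMinor (hprime.dvd_of_dvd_pow h))
      (det_pow_dvd hP)
  have hdet0 : (ZZ n).det ^ (2 * (n + 2)) ≠ 0 :=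
    pow_ne_zero _ (Matrix.det_mvPolynomialX_ne_zero (Fin (n + 2)) ℂ)
  have hhomD : IsWeightedHomogeneous (wRC (n + 2)) ((ZZ n).det ^ (2 * (n + 2)))
      ((2 * (n + 2)) • ((fun _ => 1, fun _ => 1) : (Fin (n + 2) → ℕ) × (Fin (n + 2) → ℕ))) :=
    (isWeightedHomogeneous_det (n := n)).pow _
  have hhom1 : IsWeightedHomogeneous (wRC (n + 2)) P₁
      ((fun i => if i = Fin.last (n + 1) then 2 * (n + 2) else 0), fun _ => 2) := by
    refine isWeightedHomogeneous_of_mul hhomD hdet0 (hP₁ ▸ isWeightedHomogeneous_P hP) ?_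
    refine Prod.ext (funext fun i => ?_) (funext fun j => ?_)
    · simp only [Prod.smul_fst, Prod.fst_add, Pi.add_apply, Pi.smul_apply, smul_eq_mul, mul_one, rho]
      split_ifs <;> ring
    · simp only [Prod.smul_snd, Prod.snd_add, Pi.add_apply, Pi.smul_apply, smul_eq_mul, mul_one]
      ring
  have hsupp : P₁.support ⊆ {e0 n} := fun e he =>
    Finset.mem_singleton.mpr (eq_e0 (hhom1 (mem_support_iff.mp he)))
  have hP₁eq : P₁ = monomial (e0 n) (coeff (e0 n) P₁) := by
    conv_lhs => rw [P₁.as_sum]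
    rw [Finset.sum_subset hsupp fun e _ hne => by rw [notMem_support_iff.mp hne, map_zero],
      Finset.sum_singleton]
  refine Submodule.mem_span_singleton.mpr ⟨coeff (e0 n) P₁, ?_⟩
  conv_rhs => rw [hP₁, hP₁eq]
  rw [P0, ← mul_smul_comm, smul_monomial, smul_eq_mul, mul_one]

/-- **At most one dimension**: a subspace of `ℂ[Mat_N]` all of whose members satisfy the
hypotheses has dimension `≤ 1`. [cite: IkenmeyerKandasamy2019, Thm. 4.3 (second bullet)] -/
theorem finrank_le_one_of_forall_isIKPoly (V : Submodule ℂ (Rm n)) (hV : ∀ P ∈ V, IsIKPoly χ P) :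
    Module.finrank ℂ V ≤ 1 := by
  have hle : V ≤ Submodule.span ℂ {P0 n} := fun P hP => mem_span_P0 (hV P hP)
  calc Module.finrank ℂ V ≤ Module.finrank ℂ (Submodule.span ℂ ({P0 n} : Set (Rm n))) :=
        Submodule.finrank_mono hle
    _ ≤ ({P0 n} : Set (Rm n)).toFinset.card := finrank_span_le_card _
    _ = 1 := by simp

end Structure

/-! ### §9 The Chow side: `mult_{ν^*} ℂ[\overline{GL_N · x_1⋯x_N}] ≤ 1` -/

section Chow

open Literature.NumberTheory.DiophantineGeometry
open Literature.Barriers.ValiantsHypothesis (chowMonomial)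

/-- Diagonal substitutions rescale `x_1⋯x_N` by the determinant. [folklore] -/
private theorem linSubst_diagonal_chowMonomial (N : ℕ) (t : Fin N → ℂ) :
    linSubst (Fin N) ℂ (Matrix.diagonal t) (chowMonomial ℂ N) = C (∏ i, t i) * chowMonomial ℂ N := by
  have hX : ∀ i : Fin N, linSubst (Fin N) ℂ (Matrix.diagonal t) (X i) = C (t i) * X i := by
    intro i
    rw [linSubst_X, Finset.sum_eq_single i]
    · rw [Matrix.diagonal_apply_eq, smul_eq_C_mul]
    · intro j _ hj; rw [Matrix.diagonal_apply_ne _ hj, zero_smul]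
    · intro h; exact absurd (Finset.mem_univ _) h
  show linSubst (Fin N) ℂ (Matrix.diagonal t) (∏ i : Fin N, X i) = C (∏ i, t i) * ∏ i : Fin N, X i
  rw [map_prod]
  simp_rw [hX]
  rw [Finset.prod_mul_distrib, map_prod]

/-- **IK Thm. 4.3, second bullet (general weight form)**: for `N = n + 2` and a weight `χ` with
`χ = -(2N, …, 2N, 4N)`, i.e. `χ = ν^*` for `ν = (4N, 2N, …, 2N)`, the multiplicity of `χ` in
`ℂ[\overline{GL_N · x_1⋯x_N}]_{2N+2}` is at most `1`: the injection
`HW_χ ↪ ℂ[Mat_N]` (`hwToPoly`) lands in the semi-invariants classified by `mem_span_P0`.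
(The printed proof bounds this multiplicity by the number of semistandard tableaux of shape `ν`
and content `((2N+2)^N)` via [IK'20, Lemma 9.1 / §5(C)]; here the unique tableau is replaced by the
unique semi-invariant `det^{2N} ∏_j z_{N-1,j}^2`.) [cite: IkenmeyerKandasamy2019, Thm. 4.3 (second bullet)] -/
theorem orbitMultiplicity_chowMonomial_le_one (n : ℕ) (χ : Weight (Fin (n + 2)))
    (hχ : ∀ i, χ i = -(rho n i : ℤ)) :
    orbitMultiplicity ℂ (chowMonomial ℂ (n + 2)) (n + 2) χ ≤ 1 := by
  have key : ∀ x : highestWeightSpace (orbitCoordRep (chowMonomial ℂ (n + 2)) (n + 2)) χ,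
      IsIKPoly χ (hwToPoly (chowMonomial ℂ (n + 2)) (n + 2) χ x) := by
    intro x
    obtain ⟨F, hF⟩ := Ideal.Quotient.mk_surjective (x : OrbitCoordRing (chowMonomial ℂ (n + 2)) (n + 2))
    have hx : Ideal.Quotient.mk (orbitVanishingIdeal (chowMonomial ℂ (n + 2)) (n + 2)) F ∈
        highestWeightSpace (orbitCoordRep (chowMonomial ℂ (n + 2)) (n + 2)) χ := by
      rw [hF]; exact x.2
    have hΓx : hwToPoly (chowMonomial ℂ (n + 2)) (n + 2) χ x =
        orbitCoordToPoly (chowMonomial ℂ (n + 2)) (n + 2)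
          (Ideal.Quotient.mk (orbitVanishingIdeal (chowMonomial ℂ (n + 2)) (n + 2)) F) := by
      rw [hwToPoly_apply, ← hF]
    rw [hΓx]
    refine ⟨fun b hb g => eval_orbitCoordToPoly_mul_left _ _ hx hb g,
      fun a b hab g => eval_orbitCoordToPoly_mul_right _ _ F ?_ g, hχ⟩
    rw [linSubstRep_apply, coe_torusElt, linSubst_diagonal_chowMonomial, prod_tAB n hab, C_1, one_mul]
  have hrange : ∀ P ∈ LinearMap.range (hwToPoly (chowMonomial ℂ (n + 2)) (n + 2) χ), IsIKPoly χ P := by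
    rintro _ ⟨x, rfl⟩; exact key x
  calc orbitMultiplicity ℂ (chowMonomial ℂ (n + 2)) (n + 2) χ
      = Module.finrank ℂ (highestWeightSpace (orbitCoordRep (chowMonomial ℂ (n + 2)) (n + 2)) χ) := rfl
    _ = Module.finrank ℂ (LinearMap.range (hwToPoly (chowMonomial ℂ (n + 2)) (n + 2) χ)) :=
        (LinearMap.finrank_range_of_inj (hwToPoly_injective _ _ χ)).symm
    _ ≤ 1 := finrank_le_one_of_forall_isIKPoly _ hrange

end Chow

/-! ### §10 IK Thm. 4.3, second bullet, for `ν = (4m, 2m, …, 2m)` -/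

open _root_.Literature.Barriers.ValiantsHypothesis (chowMonomial) in
/-- **IK Thm. 4.3, second bullet**: `mult_{ν^*} ℂ[\overline{GL_m · x_1⋯x_m}] ≤ 1`, `m = 2k + 4`.
[cite: IkenmeyerKandasamy2019, Thm. 4.3 (second bullet)] -/
theorem orbitMultiplicity_chow_le_one :
    orbitMultiplicity ℂ (chowMonomial ℂ (2 * k + 4)) (2 * k + 4)
      (Weight.dualOfPartition (2 * k + 4) (ikPartition (2 * k + 4))) ≤ 1 :=
  orbitMultiplicity_chowMonomial_le_one (2 * k + 2) _ fun i => by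
    have hx : xEnum k (2 * k + 3 - (i : ℕ)) = i := Fin.ext (by rw [xEnum_val₂]; omega)
    have h1 := dualOfPartition_ikPartition_xEnum₂ k (2 * k + 3 - (i : ℕ)) (by omega)
    rw [hx] at h1
    rw [h1]
    unfold rho
    have hi : i = Fin.last (2 * k + 2 + 1) ↔ 2 * k + 3 - (i : ℕ) = 0 := by
      rw [Fin.ext_iff, Fin.val_last]; omega
    by_cases h : 2 * k + 3 - (i : ℕ) = 0
    · rw [if_pos h, if_pos (hi.mpr h)]; push_cast; ring
    · rw [if_neg h, if_neg (mt hi.mp h)]; push_cast; ring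

end IK2020

/-- **DISCHARGE of `IK2020_thm_4_3`** (Ikenmeyer–Kandasamy 2020, Thm. 4.3): for every even
`m ≥ 4`, with `ν = (2m) + (m × 2m) = (4m, 2m, …, 2m) ⊢ m(2m+2)`,
`mult_{ν^*} ℂ[\overline{GL_m (x_1^m + ⋯ + x_m^m)}] ≥ 2` and
`mult_{ν^*} ℂ[\overline{GL_m x_1⋯x_m}] ≤ 1` — "`ν` is a multiplicity obstruction showing
`\overline{GL_m p} ⊄ \overline{GL_m x_1⋯x_m}`". Proved by elementary certificates (two explicit
highest-weight vectors with a triangular evaluation matrix; classification of the Borel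
semi-invariants of weight `ν^*` on `Mat_m` that are invariant under the stabilizing torus), not by
the printed Tableau-Lifting route. [cite: IkenmeyerKandasamy2019, Thm. 4.3] -/
theorem IK2020_thm_4_3_holds : IK2020_thm_4_3 := by
  intro m h4 heven
  obtain ⟨r, hr⟩ := heven
  obtain rfl : m = 2 * (r - 2) + 4 := by omega
  exact ⟨IK2020.two_le_orbitMultiplicity_psum (r - 2), IK2020.orbitMultiplicity_chow_le_one (r - 2)⟩

end Literature.Computability.AlgebraicComplexity

end
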